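import Literature.MathematicalPhysics.QuantumFieldTheory.Balaban1983to89.FlowStep
import Literature.MathematicalPhysics.QuantumFieldTheory.Balaban1983to89.BetaDerivClause
import Literature.MathematicalPhysics.QuantumFieldTheory.Balaban1983to89.T4CauchySum

/-!
# `Balaban1983to89.T4CouplingMatching` — node U2 COUPLING MATCHING of the uniqueness spine (cell `pub-balaban`,
T4-DAG v0/v1 §2 U2 / §5 row T4-U2.E / §6 NE4): the located estimate NE4 TYPED, and the backward coupling-matching
recursion KERNEL-CHECKED (bookkeeping; FlowStep vocabulary)

HONEST FRAMING (T4-DAG v0 PAGE 1).  The cell's T4 target is the existence AND uniqueness of the continuum limit of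
Bałaban's unit-scale expectations on a finite torus — a constructive-QFT statement strictly beyond ultraviolet
stability; it is NOT the Yang–Mills mass gap and NOT the Clay problem.  This module is node U2 of that spine: the
comparison of the running couplings of two infrared-matched runs of the recursion (0.20).  It ASSERTS NOTHING about
Bałaban's β-functions: every `def … : Prop` below is a HYPOTHESIS SHAPE (the cell's typing of an estimate that is NOT
in print — T4-DAG §6 NE4 and GAPS G-t4-U2-1, G-t4-U2-2), consumed only as a hypothesis, and every theorem is elementary real
analysis (finite sums, a backward discrete Grönwall inequality, a weighted-maximum fixed-point argument, one square-root
telescoping).  Value = typed located estimate + kernel bookkeeping of an implication ⇐ named inputs; NOT summit progress.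

CITATION HEADER (lean-in-tree rule 2026-08-18).  Typed skeleton around T. Bałaban, *Renormalization group approach to
lattice gauge field theories. I*, Commun. Math. Phys. **109** (1987) 249–301 [Balaban1987RG1] (cell paper B12; PDF
page = journal page − 248).  WHAT IS PRINTED and used here (verbatim, read by this seat on the renders
`b2b-balaban-ref1/pages/1987-cmp109-rg-I-small-field-p008/p016/p050-x2.png`; loci (Q2), (Q5), (Q8) of the node's
cross-read `t4/T4-XREAD-U2.md`, GAPS C-pv13g2-18):
* p. 256 [PDF 8]: "the coupling constant g_{k+1} is determined from the equation 1/g_k² = 1/g²_{k+1} + β_{k+1}(g_k).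
  (0.20)" — "We continue the calculation of the effective actions until we reach the unit lattice, or rather until we
  reach a scale which we define as the unit scale. Let us denote the corresponding index by K, hence ε = L^{−K}, and
  the sequence of actions and coupling constants is defined for k = 0, 1, ..., K."  (Tree: `FlowStep.RGEqH`.)
* p. 264 [PDF 16]: "This is the vacuum polarization tensor of the theory defined by the j-th fluctuation field
  integral." — of β_{j+1}(g_j): "It is a smooth function defined on the interval [0, γ], (or analytic), uniformly
  bounded on this interval together with all derivatives. We will investigate other properties in a separate paper." —
  Theorem 3: "The constant γ depends on all other constants."
* (v1.2, format clause §6; renders p015/p016 re-read as images by unit `b2b-balaban-pv16` gen 4; loci (L4) of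
  `t4/T4-REF-O3.md`, GAPS C-pv10-23) p. 263 [PDF 15]: "Other symmetries are Euclidean lattice transformations. We
  assume that the action (1.3) is invariant with respect to the transformations of the lattice T^{(k)}. More precisely,
  we notice that the explicitly defined expressions in the j-th term in (1.3) are invariant with respect to the Euclidean
  transformations of the lattice T^{(j+1)}, and we assume that this is true for all expressions in this term." — p. 264
  [PDF 16]: "the β-functions β_{j+1}(g_j). They are determined by the functions E^{(j+1)}(g_j, U_{j+1}) in (1.6). Let us
  denote E^{(j+1)}(g_j, B) = E^{(j+1)}(g_j, U_{j+1}(exp iB)). We define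
  Π^{ab}_{j+1,μν}(g_j, x, x′) = (δ²/δB^a_μ(x)δB^b_ν(x′) E^{(j+1)})(g_j, 0). (1.20)" — "The function (1.20) can be
  considered as a function of μ, ν, x, x′, with values in the tensor product g⊗g, […]. By the Euclidean invariance of
  E^{(j+1)} the function (1.20) is Euclidean covariant. This implies Π^{ab}_{j+1,μν}(g_j, x, x′) = δ^{ab}Π_{j+1,μν}(g_j,
  x − x′), Π_{j+1}(g_j, rb, rb′) = Π_{j+1}(g_j, b, b′), (1.21) where Π_{j+1,μν}(g_j, x) is a real valued function, and
  r is a Euclidean rotation leaving the lattice T^{(j+1)} invariant. Now we take a limit of these functions as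
  T^{(j+1)} ↗ Z^d. This limit exists by the localized representation (1.7)." — and (1.22) "β_{j+1}(g_j) = […]
  = Σ_x Π_{j+1,μν}(g_j, x)x_μx_ν (1.22) for μ, ν arbitrary, μ ≠ ν" (tree: `B12Beta.Kernel`, `B12Beta.secondMoment`,
  `B12Beta.PermCovariant`).
* p. 298 [PDF 50]: "In fact we should write the superscript (j) at the tensor in the formula (5.42) defining the
  function β_j. We write β_j as explicitly dependent on g_{j−1}, although it depends also on all preceding coupling
  constants. The dependence on g_{j−1} is important and it determines main properties of the renormalization group
  equations."  (Tree: the history typing `FlowStep.HBeta`, `β k v = β_{k+1}(g_0,…,g_k)`.)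
WHAT IS NOT PRINTED (the node's cross-read, `t4/T4-XREAD-U2.md` §3, verdict NO; GAPS G-t4-U2-1, G-t4-U2-2): any
statement on the dependence of β_{j} on the scale j (η = L^{−j}) — no convergence, no rate, no η-difference bound — and
any modulus for the dependence on the preceding couplings.  Hence §1's predicates are HYPOTHESES.  The printed TEMPLATE of
a geometric scale-rate in a sibling model is C. King, Commun. Math. Phys. **102** (1986), Thm 3.4 (3.9) p. 656 (U(1)
Higgs₂,₃; quoted in the sibling `T4CauchySum`), cited for the SHAPE only.

THE MODELLING POINT (cell T4-DAG §1 D3, §2 U2).  Run A = K steps from ε = L^{−K}, run B = K + 1 steps from ε/L, both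
ending at the renormalized coupling: g^A_K = g^B_{K+1} (the renormalization condition of Theorem 2 p. 259).  ONE family
`β : FlowStep.HBeta` serves both runs: `β k` is the function produced by the k-th fluctuation integral over a history of
k + 1 couplings, i.e. its k-dependence IS the η = L^{−k} dependence (p. 264, p. 298 above); run A uses `β j` at its step
j, run B uses `β (j+1)` at its step j + 1, and the infrared matching pairs A's scale j with B's scale j + 1, coupling
g^A_i with g^B_{i+1}; B's extra, finest coupling g^B_0 has no partner.  So the matched sub-history of B's prefix
`(g^B_0, …, g^B_{j+1})` is its `Fin.tail` `(g^B_1, …, g^B_{j+1})` (drop the FIRST = ultraviolet-most entry; for a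
Markovian family this compares β_{j+2}(g) with β_{j+1}(g) AT THE SAME COUPLING, `scaleShiftRate_ofMarkov_iff` — the
cross-read's hand-off (E1) wrote `Fin.init`, which would compare different couplings; corrected here).  In the variable
x = 1/g² of (0.20) the discrepancy is `disc gA gB j = |1/(g^A_j)² − 1/(g^B_{j+1})²|`, `disc gA gB K = 0` by the pin, and
(0.20) for both runs gives, for j < K (kernel: `disc_step`),
  δ_j ≤ δ_{j+1} + |β_{j+2}(g^B_0,…,g^B_{j+1}) − β_{j+1}(g^B_1,…,g^B_{j+1})|   [scale shift at FIXED couplings: NE4 proper]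
               + |β_{j+1}(g^B_1,…,g^B_{j+1}) − β_{j+1}(g^A_0,…,g^A_j)|       [history shift at FIXED scale]
and, with `|g − g′| ≤ g²·g′·|1/g² − 1/g′²|` (`abs_sub_le_of_inv_sq`), the second term is a weighted sum of the δ_i,
i ≤ j, with weights Λ j i · (g^A_i)² g^B_{i+1} — a TWO-SIDED coupling of the unknowns (δ_{j+1} infrared of j, δ_i
ultraviolet of j).

WHAT IS KERNEL-CHECKED.
§1 NE4 TYPED (hypothesis shapes over `FlowStep.HBeta`, never facts): `ScaleShiftRate c θ γ β`
   (|β (k+1) w − β k (Fin.tail w)| ≤ c θ^k on the box ]0,γ]^{k+2} — "(AF-0r) for the FULL β"); `RemainderShiftRate`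
   (the same for the remainder β¹ of the printed one-loop split `B12Beta.OneLoopSplit`); `scaleShiftRate_of_split`:
   (AF-0r) of the β sub-cell (|β⁰_{k+1} − β⁰_∞| ≤ c₀θ^k, `Beta.Assembly.LimitForm.conv` / `Beta.LimitRate`) +
   `RemainderShiftRate c₁` ⇒ `ScaleShiftRate (2c₀ + c₁)`; the Markov sanity check `scaleShiftRate_ofMarkov_iff`;
   `HistLipschitz Λ γ β` (|β k p − β k q| ≤ Σ_i Λ k i |p_i − q_i| on the box: moduli for the dependence on EACH coupling,
   in the variable g of p. 264) with `FadingMemory C θ Λ` (Λ k i ≤ C θ^{k−i}: the memory of the coupling g_i fades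
   geometrically in the age k − i) and `LastOnlyLipschitz L` (Markov-type feedback); `histLipschitz_of_coordLipschitz`:
   the tree's uniform clause `BetaDerivClause.CoordLipschitzAt β k C γ` (all k) is the instance Λ ≡ C — recorded to make
   GAPS G-t4-U2-2 precise: a UNIFORM modulus has no fading memory (`FadingMemory C θ (fun _ _ => C)` forces C θ^{k} ≥ C,
   i.e. C = 0 or θ ≥ 1) and does NOT feed §3's theorem; `fadingMemory_diag`: the diagonal modulus of a last-only family
   IS fading (so §3 covers Markovian families).
§2 ARITHMETIC KERNELS over abstract real sequences: `backward_sum` (δ_K ≤ 0, δ_j ≤ δ_{j+1} + s_j ⇒ δ_j ≤ Σ_{i∈[j,K)} s_i);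
   `backward_geom` (s_j = sθ^j ⇒ δ_j ≤ s θ^j/(1−θ)); `backward_gronwall` (δ_j ≤ δ_{j+1} + e_j + ℓ_j δ_j, 0 ≤ ℓ_j ≤ ½ ⇒
   δ_j ≤ ∏_{m∈[j,K)}(1 + 2ℓ_m) · Σ_{i∈[j,K)} e_i) with `prod_one_add_two_mul_le_exp` (∏(1+2ℓ_m) ≤ e^{2Σℓ_m}); and the
   two-sided `twoSided_fixedPoint`: δ ≥ 0, δ_K = 0, δ_j ≤ δ_{j+1} + cθ^j + C Σ_{i≤j} θ^{j−i} u_i δ_i, Σ_{i≤K} u_i ≤ U,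
   SMALLNESS C·U ≤ (1−θ)/2 ⇒ δ_j ≤ (2c/(1−θ)) θ^j for all j ≤ K (weighted maximum M = max_i δ_i θ^{−i}; the reduced
   recursion δ_j ≤ δ_{j+1} + (c + CUM)θ^j; `backward_geom`; M ≤ (c + CUM)/(1−θ) at the maximiser; absorb).
§3 THE COUPLING MATCHING: `disc_step` (the displayed recursion, from `RGEqH K β gA`, `RGEqH (K+1) β gB`, box membership,
   `ScaleShiftRate`, `HistLipschitz`); `disc_le_of_fadingMemory` — MAIN: with `FadingMemory C θ Λ`, the pin
   g^A_K = g^B_{K+1}, Σ_{i≤K}(g^A_i)² g^B_{i+1} ≤ U and C·U ≤ (1−θ)/2: `disc gA gB j ≤ (2c/(1−θ)) θ^j` for every j ≤ K,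
   the constant INDEPENDENT OF K; `disc_le_of_lastOnly` — the node text's literal Grönwall form for Markov-type feedback,
   no smallness beyond Lγ³ ≤ ½: `disc gA gB j ≤ exp(2 Σ_{m∈[j,K)} L (g^A_m)² g^B_{m+1}) · cθ^j/(1−θ)` ("∏(1 + O(g_i²))").
§4 WHERE ASYMPTOTIC FREEDOM ENTERS: `inv_sq_lower_of_betaLower` (a trajectory-wise lower bound b ≤ β on the boxes —
   `FlowStep.BetaLowerH b γ β`, the cell's typed UNPRINTED input T09.F/H3, or any eventual form restricted to the scales
   used — gives 1/g_K² + b(K−i) ≤ 1/g_i², the discrete lower half of (0.31)); `sum_weights_le_of_betaLower`: along two such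
   runs Σ_{i≤K} (g^A_i)² g^B_{i+1} ≤ γ³ + 2γ/b, UNIFORMLY IN K (comparison with the profile a_m = 1/γ² + bm, m = K − i, and
   the telescoping `inv_cube_le_telescope`: a_m^{−3/2} ≤ (2/b)(a_{m−1}^{−1/2} − a_m^{−1/2})).  So the smallness of §3 reads
   C(γ³ + 2γ/b) ≤ (1−θ)/2 — γ small GIVEN the constants C, b, θ, a restriction of the kind Theorem 3 p. 264 places on γ
   ("The constant γ depends on all other constants"); nothing printed is claimed to verify it.  v1.1, EVENTUAL FORM:
   `EventualLowerH b γ k₀ β` (b ≤ β_{k+1} on the boxes for k ≥ k₀ only — the shape of the β-cell's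
   `Beta.Assembly.LimitForm.tail_lower`, which follows from its OPEN analytic inputs (AF-0r)/(AF-0∞)/(AF-1) WITHOUT the
   finite list of small-k signs that the all-k form additionally encodes, `Beta.Assembly` §1.3; module not imported),
   `inv_sq_lower_of_eventualLower`, `sum_profWeights_le`, `sum_weights_le_of_eventualLower`: Σ_{i≤K} (g^A_i)² g^B_{i+1}
   ≤ (k₀+1)γ³ + 2γ/b, still UNIFORM IN K (the first k₀ weights are ≤ γ³ each by the box alone); the all-k statements are
   the case k₀ = 0 (`eventualLowerH_of_betaLowerH`, `betaLowerH_iff_eventualLowerH_zero`).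
§5 OUTPUT IN THE SPINE'S SHAPE: `injectedRate_of_runs` — for a family of runs K ↦ g^{(K)} (K steps, all pinned at the
   same renormalized coupling, all in ]0,γ]), §3 + §4 give `T4CauchySum.InjectedRate (2c/(1−θ)) 0 θ (fun K j ↦
   disc g^{(K)} g^{(K+1)} j)` — the U2 source of node U6's Cauchy sum with polynomial exponent 0.  v1.1:
   `injectedRate_of_runs_eventual` (the same from `EventualLowerH`, smallness C((k₀+1)γ³ + 2γ/b) ≤ (1−θ)/2) and
   `injectedRate_of_runs_lastOnly` (from `LastOnlyLipschitz L` + `EventualLowerH`, NO smallness beyond Lγ³ ≤ ½: rate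
   constant exp(2L((k₀+1)γ³ + 2γ/b))·c/(1−θ), exponent 0).

§6 FORMAT CLAUSE (v1.2; T4-DAG v3 row T4-U2.F, `t4/T4-REF-O3.md` V6, GAPS G-pv10-7 — a CONVENTION of the cell's dressed
   format, recorded where the coupling recursion lives; nothing printed is contradicted or asserted).  In node O3b's
   DRESSED format the (j+1)-st effective action carries the observable strength μ (a Wilson loop / smeared observable
   glued to its tube 𝒯(C)): E^{(j+1)}_μ.  Its μ = 0 part E^{(j+1)}_0 IS Bałaban's undressed action — the observable
   insertion is the only μ-dependence of the flow — so the p. 263 Euclidean-invariance assumption (verified for the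
   small-field actions by Theorem 3 p. 264) and hence (1.21) apply to it; for μ ≠ 0 the μ-part is glued to 𝒯(C), is NOT
   Euclidean invariant, and (1.21) is false verbatim for E^{(j+1)}_μ (`t4/T4-REF-O3.md` V6).  THE CLAUSE: the two-point
   function (1.20), the kernel Π_{j+1} of (1.21), β_{j+1} of (1.22) — and every renormalisation extraction of §5 of the
   paper — are COMPUTED FROM THE μ = 0 PART; the whole μ-dependence rides in the observable-attached class of node O3b,
   which never feeds the recursion (0.20)/(1.6).  Typed: `TwoPoint` (the function of μ, ν, x, x′ of p. 264, colour δ^{ab}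
   stripped), `TranslationInvariant` + `toKernel` + `toKernel_spec` (the first line of (1.21) as a hypothesis on a
   two-point function and the kernel it then defines), `ReadOffMuZero q :⇔ ∀ μ, q μ = q 0` (a μ-indexed quantity is read
   off the μ = 0 part), `kernelMuZero` / `betaMuZero` (the format's DEFINITIONS of Π_{j+1} and of the number (1.22) from
   the μ = 0 member of a dressed family of two-point functions; `betaMuZero_congr`: they depend on the family only through
   that member; `kernelMuZero_spec`: (1.21) first line for the μ = 0 member GIVEN its translation invariance), and the
   plumbing `rgEqH_dressed_iff` / `disc_dressed_eq` / `injectedRate_of_dressedRuns_eventual`: under `ReadOffMuZero βd`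
   the coupling sequences, the discrepancies `disc` and node U2's injected rate of dressed runs are LITERALLY those of §5
   for the undressed family `βd 0` — the observable never enters node U2.  CONSISTENCY (not typed here; `t4/T4-REF-O3.md`
   V5 (v), GAPS G-pv10-6): the clause forbids any extraction from the μ-part, so it is consistent iff the
   observable-attached sizes are summable over scales — the tube budget (TOB-k) of node O3b (row T4-O3b.B); were (TOB-k)
   to fail, the failure would surface as a non-summable μ-linear perimeter-type coupling needing its own renormalisation,
   which this format has no slot for.  Node U5a inherits the clause: every synchronised threshold of
   `T4SyncThresholds` is a function of the (μ-independent) coupling sequences (`t4/T4-XREAD-U5a.md` v1.2 §4 (F-μ0)).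

ON THE NODE TEXT'S "∏(1 + O(g_i²)) ≤ K^c" AND "δ_j ≤ K^c θ^j/(1−θ)" (T4-DAG §2 U2, §5 row; cell DIVERGENCE D-pv16.3).
Measured in the recursion variable x = 1/g², a Lipschitz modulus in the coupling g (the p. 264 variable) carries the
weight (g^A_i)² g^B_{i+1} = O(g³), which is SUMMABLE along asymptotically free runs (§4) — so both the Grönwall constant
of `disc_le_of_lastOnly` and the fixed-point constant of `disc_le_of_fadingMemory` are K-UNIFORM.  The polynomial K^c
arises only from the cruder weight γ·g_i² with Σ_{i<K} g_i² = O(log K); that route remains available through the sibling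
`T4CauchySum.prod_one_add_mul_le_exp_mul_rpow`, and `T4CauchySum.InjectedRate` accepts either (exponent c : ℕ, here 0).
WHY THE HYPOTHESES MIGHT FAIL for (1.22) (cell GAPS G-pv16-2): `FadingMemory` with θ < 1 is a genuine structural claim
about the terms E^{(j)} of [Balaban1987RG1] (the coupling g_i enters β_{k+1}, k > i, only through irrelevant terms born
at scale i) for which print offers the p. 298 sentence only; with a uniform, non-fading modulus the two-sided recursion
is not closed by anything here (nor, as far as this seat can see, by anything short of a new idea).

Deliberately NOT here: any proof of `ScaleShiftRate` / `RemainderShiftRate` / `HistLipschitz` for Bałaban's (1.22)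
(estimate rows of the β sub-cell an1–an4 and of node U1 — propagator convergence with rate); the relative discrepancy
g_j²δ_j and its consumption by node U3; the endpoint existence g_K = g itself (node H3; `FlowStepRuns`).  Imports
`FlowStep` (hence `Step`, `Missing`, `B12Beta`), `BetaDerivClause` (for the instance remark only) and `T4CauchySum`
(for the output shape only); Mathlib otherwise; no `sorry`/`axiom`.  Unit `b2b-balaban-pv16` gen 3 (ACTING claim on row
T4-U2.E); records `HOME/t4/T4-XREAD-U2.md` (input), GAPS C-pv16-4 / G-pv16-2 (v1.1: G-pv16-2 (b) narrowed — the all-k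
lower bound is no longer needed, the eventual one suffices), DIVERGENCE D-pv16.3; v1 cross-read GAPS C-pv01-11 (ok);
v1.2 (§6 format clause, header bullet p. 263/p. 264): unit `b2b-balaban-pv16` gen 4, row T4-U2.F, GAPS C-pv16g4-3 /
G-pv16g4-5, companion `HOME/t4/T4-XREAD-U5a.md` v1.2 §4 (F-μ0).
-/

namespace Literature.MathematicalPhysics.QuantumFieldTheory.Balaban1983to89.T4CouplingMatching

open Literature.MathematicalPhysics.QuantumFieldTheory.Balaban1983to89
open Literature.MathematicalPhysics.QuantumFieldTheory.Balaban1983to89.FlowStep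
open Finset

/-! ## §1 NE4 typed: the scale-shift rate of the full β-functions, and the history moduli (hypothesis shapes) -/

/-- HYPOTHESIS SHAPE — NE4, the SCALE-SHIFT RATE OF THE FULL β-FUNCTIONS ("(AF-0r) for the full β", cell T4-DAG §6
NE4): for every scale `k` and every history `w = (g_0, …, g_{k+1}) ∈ ]0,γ]^{k+2}`,
`|β_{k+2}(g_0, …, g_{k+1}) − β_{k+1}(g_1, …, g_{k+1})| ≤ c θ^k` — the β-function of the (k+1)-st fluctuation integral of a
run with ONE MORE ultraviolet scale, at the infrared-matched couplings, differs from the k-th one by a geometric rate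
(`Fin.tail w` drops the extra, finest coupling `g_0`).  NOT PRINTED in any form ([Balaban1987RG1] p. 264 "We will
investigate other properties in a separate paper"; cross-read `t4/T4-XREAD-U2.md` §3); its β⁰-half is the β sub-cell's
(AF-0r), its β¹-half is new (`RemainderShiftRate`).  Printed template of the shape: King's (3.9).
[cite: King1986, Thm 3.4 (3.9) p. 656] -/
def ScaleShiftRate (c θ γ : ℝ) (β : HBeta) : Prop :=
  ∀ k (w : Fin (k + 2) → ℝ), w ∈ Box γ (k + 1) → |β (k + 1) w - β k (Fin.tail w)| ≤ c * θ ^ k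

/-- HYPOTHESIS SHAPE — the β¹-half of NE4: for the remainder `β¹` of the PRINTED one-loop split
`β_{k+1} = β⁰_{k+1} + β¹_{k+1}(g_0,…,g_k)` ([Balaban1987RG1] (2.12)–(2.14) p. 268, tree `B12Beta.OneLoopSplit`),
`|β¹_{k+2}(w) − β¹_{k+1}(Fin.tail w)| ≤ c₁ θ^k` on ]0,γ]^{k+2}.  NOT PRINTED (cell T4-DAG §6 NE4: "β¹ remainder: new").
[cite: Balaban1987RG1, (2.12)–(2.14) p.268] -/
def RemainderShiftRate {β : HBeta} (S : B12Beta.OneLoopSplit β) (c₁ θ γ : ℝ) : Prop :=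
  ∀ k (w : Fin (k + 2) → ℝ), w ∈ Box γ (k + 1) → |S.β1 (k + 1) w - S.β1 k (Fin.tail w)| ≤ c₁ * θ ^ k

/-- (AF-0r) + the remainder's scale-shift rate ⇒ NE4 for the full β: if `|β⁰_{k+1} − β⁰_∞| ≤ c₀θ^k` for all k (the β
sub-cell's (AF-0r), e.g. the field `conv` of `Beta.Assembly.LimitForm`; `0 ≤ θ ≤ 1`, `0 ≤ c₀`) and
`RemainderShiftRate S c₁ θ γ`, then `ScaleShiftRate (2c₀ + c₁) θ γ β` (triangle inequality through β⁰_∞ and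
θ^{k+1} ≤ θ^k). [folklore] -/
theorem scaleShiftRate_of_split {β : HBeta} (S : B12Beta.OneLoopSplit β) {binf c₀ c₁ θ γ : ℝ}
    (hθ0 : 0 ≤ θ) (hθ1 : θ ≤ 1) (hc₀ : 0 ≤ c₀)
    (hconv : ∀ k, |S.β0 k - binf| ≤ c₀ * θ ^ k) (hrem : RemainderShiftRate S c₁ θ γ) :
    ScaleShiftRate (2 * c₀ + c₁) θ γ β := by
  intro k w hw
  have h1 := hconv (k + 1)
  have h2 := hconv k
  have h3 := hrem k w hw
  have hθk : θ ^ (k + 1) ≤ θ ^ k := pow_le_pow_of_le_one hθ0 hθ1 (Nat.le_succ k)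
  have e : β (k + 1) w - β k (Fin.tail w)
      = (S.β0 (k + 1) - binf) - (S.β0 k - binf) + (S.β1 (k + 1) w - S.β1 k (Fin.tail w)) := by
    rw [S.split (k + 1) w, S.split k (Fin.tail w)]; ring
  rw [e]
  calc |(S.β0 (k + 1) - binf) - (S.β0 k - binf) + (S.β1 (k + 1) w - S.β1 k (Fin.tail w))|
      ≤ |S.β0 (k + 1) - binf| + |S.β0 k - binf| + |S.β1 (k + 1) w - S.β1 k (Fin.tail w)| :=
        (abs_add_le _ _).trans (add_le_add (abs_sub _ _) le_rfl)
    _ ≤ c₀ * θ ^ (k + 1) + c₀ * θ ^ k + c₁ * θ ^ k := add_le_add (add_le_add h1 h2) h3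
    _ ≤ (2 * c₀ + c₁) * θ ^ k := by nlinarith [mul_le_mul_of_nonneg_left hθk hc₀]

/-- SANITY OF THE DIRECTION OF THE SHIFT: for a Markovian family `FlowStep.ofMarkov βM` (β_{k+1} a function of g_k
alone), `ScaleShiftRate c θ γ` says exactly `|βM (k+2) g − βM (k+1) g| ≤ c θ^k` for `g ∈ ]0,γ]` — consecutive
β-functions compared AT THE SAME COUPLING, i.e. the pure η = L^{−k} → L^{−k−1} rate.  (With `Fin.init` in place of
`Fin.tail` one would compare `βM (k+2) g_{k+1}` with `βM (k+1) g_k`, different couplings — the reason for the correction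
of the cross-read's hand-off (E1).) [folklore] -/
theorem scaleShiftRate_ofMarkov_iff {c θ γ : ℝ} {βM : ℕ → ℝ → ℝ} :
    ScaleShiftRate c θ γ (ofMarkov βM) ↔
      ∀ k (g : ℝ), 0 < g → g ≤ γ → |βM (k + 2) g - βM (k + 1) g| ≤ c * θ ^ k := by
  constructor
  · intro h k g hg0 hgγ
    have hw : (fun _ : Fin (k + 2) => g) ∈ Box γ (k + 1) := mem_box.mpr fun _ => ⟨hg0, hgγ⟩
    simpa [ofMarkov, Fin.tail] using h k _ hw
  · intro h k w hw
    have := h k (w (Fin.last (k + 1))) (mem_box.mp hw _).1 (mem_box.mp hw _).2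
    simpa [ofMarkov, Fin.tail, Fin.succ_last] using this

/-- HYPOTHESIS SHAPE — HISTORY MODULI: on the box ]0,γ]^{k+1}, `|β_{k+1}(p) − β_{k+1}(q)| ≤ Σ_{i≤k} Λ k i · |p_i − q_i|`,
a Lipschitz modulus `Λ k i` for the dependence of `β_{k+1}` on EACH coupling `g_i`, `i ≤ k`, in the variable g of
[Balaban1987RG1] p. 264 ("uniformly bounded on this interval together with all derivatives" — said of the LAST variable,
per scale).  About the dependence on the PRECEDING couplings print says only that it exists (p. 298); any quantitative
modulus is UNPRINTED (GAPS G-t4-U2-2).  The tree's uniform clause `BetaDerivClause.CoordLipschitzAt` is the instance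
`Λ ≡ C` (`histLipschitz_of_coordLipschitz`). [cite: Balaban1987RG1, §5 p.298 and §1 p.264] -/
def HistLipschitz (Λ : ℕ → ℕ → ℝ) (γ : ℝ) (β : HBeta) : Prop :=
  ∀ k (p q : Fin (k + 1) → ℝ), p ∈ Box γ k → q ∈ Box γ k →
    |β k p - β k q| ≤ ∑ i : Fin (k + 1), Λ k i * |p i - q i|

/-- HYPOTHESIS SHAPE — FADING MEMORY of the history moduli: `0 ≤ Λ k i ≤ C θ^{k−i}` for `i ≤ k` — the influence of
the coupling `g_i` on `β_{k+1}` decays geometrically in the age `k − i` (heuristically: `g_i` enters the k-th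
fluctuation integral only through terms born at scale i, which are irrelevant and contract).  A genuine structural
claim about [Balaban1987RG1]'s `E^{(j)}`, NOT PRINTED; it is what closes the two-sided recursion of §3
(`disc_le_of_fadingMemory`).  Rates can always be worsened, so one `θ` is shared with `ScaleShiftRate`. [cite: Balaban1987RG1, §5 p.298] -/
def FadingMemory (C θ : ℝ) (Λ : ℕ → ℕ → ℝ) : Prop :=
  ∀ k i, i ≤ k → 0 ≤ Λ k i ∧ Λ k i ≤ C * θ ^ (k - i)

/-- The tree's UNIFORM coordinatewise clause is an instance: `CoordLipschitzAt β k C γ` for every k (row BETA-an4's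
typing, `BetaDerivClause`) gives `HistLipschitz (fun _ _ => C) γ β` (`BetaDerivClause.abs_sub_le_sum_of_coordLipschitz`).
Recorded to make GAPS G-t4-U2-2 precise: a constant modulus has NO fading memory (for `C > 0`, `θ < 1`, `k ≥ 1`,
`FadingMemory C θ (fun _ _ => C)` fails at `i = 0`), so this instance does NOT feed `disc_le_of_fadingMemory`. [folklore] -/
theorem histLipschitz_of_coordLipschitz {β : HBeta} {C γ : ℝ}
    (h : ∀ k, BetaDerivClause.CoordLipschitzAt β k C γ) : HistLipschitz (fun _ _ => C) γ β := by
  intro k p q hp hq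
  have := BetaDerivClause.abs_sub_le_sum_of_coordLipschitz (h k) hq hp
  simpa [Finset.mul_sum] using this

/-- HYPOTHESIS SHAPE — MARKOV-TYPE FEEDBACK: on the box, `|β_{k+1}(p) − β_{k+1}(q)| ≤ L |p_k − q_k|` (so, on the box,
`β_{k+1}` depends on the last coupling only, Lipschitz with one constant `L`: the literal reading of (0.20)'s
"β_{k+1}(g_k)" p. 256 together with the p. 264 derivative clause made uniform in k — the uniformity is UNPRINTED, GAPS
G-adv2-3/G-b12-2; for `FlowStep.ofMarkov βM` it is a Lipschitz bound on each `βM (k+1)` on ]0,γ]).  The hypothesis of the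
node text's literal Grönwall form `disc_le_of_lastOnly`. [cite: Balaban1987RG1, (0.20) p.256 and §1 p.264] -/
def LastOnlyLipschitz (L γ : ℝ) (β : HBeta) : Prop :=
  ∀ k (p q : Fin (k + 1) → ℝ), p ∈ Box γ k → q ∈ Box γ k →
    |β k p - β k q| ≤ L * |p (Fin.last k) - q (Fin.last k)|

/-- The DIAGONAL modulus of a last-only family, `Λ k i = L·[i = k]`, has fading memory with constant `L` and ANY rate
`θ ≥ 0` (so `disc_le_of_fadingMemory` covers Markovian families; there the smallness reads `L(γ³ + 2γ/b) ≤ (1−θ)/2`).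
[folklore] -/
theorem fadingMemory_diag {L θ : ℝ} (hL : 0 ≤ L) (hθ : 0 ≤ θ) :
    FadingMemory L θ (fun k i => if i = k then L else 0) := by
  intro k i hik
  by_cases h : i = k
  · subst h; simp [hL]
  · simp only [h, if_false]
    exact ⟨le_rfl, mul_nonneg hL (pow_nonneg hθ _)⟩

/-- A last-only Lipschitz family has the diagonal history moduli. [folklore] -/
theorem histLipschitz_of_lastOnly {β : HBeta} {L γ : ℝ} (h : LastOnlyLipschitz L γ β) :
    HistLipschitz (fun k i => if i = k then L else 0) γ β := by
  intro k p q hp hq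
  have e : ∑ i : Fin (k + 1), (if (i : ℕ) = k then L else 0) * |p i - q i|
      = L * |p (Fin.last k) - q (Fin.last k)| := by
    rw [Finset.sum_eq_single (Fin.last k)]
    · simp
    · intro i _ hi
      have : (i : ℕ) ≠ k := fun h' => hi (Fin.ext (by simp [h']))
      simp [this]
    · simp
  rw [e]
  exact h k p q hp hq

/-! ## §2 Arithmetic kernels: backward accumulation, backward discrete Grönwall, two-sided fixed point -/

/-- BACKWARD ACCUMULATION: if `δ_K ≤ 0` and `δ_j ≤ δ_{j+1} + s_j` for `j < K`, then `δ_j ≤ Σ_{i ∈ [j,K)} s_i` for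
`j ≤ K` (descending induction from the infrared pin). [folklore] -/
theorem backward_sum {K : ℕ} {δ s : ℕ → ℝ} (hK : δ K ≤ 0) (hrec : ∀ j, j < K → δ j ≤ δ (j + 1) + s j) :
    ∀ j, j ≤ K → δ j ≤ ∑ i ∈ Ico j K, s i := by
  suffices H : ∀ d j, j + d = K → δ j ≤ ∑ i ∈ Ico j K, s i from
    fun j hj => H (K - j) j (Nat.add_sub_cancel' hj)
  intro d
  induction d with
  | zero => intro j hj; rw [add_zero] at hj; subst hj; simpa using hK
  | succ d ih =>
    intro j hj
    have hjK : j < K := by omega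
    have h1 := hrec j hjK
    have h2 := ih (j + 1) (by omega)
    rw [Finset.sum_eq_sum_Ico_succ_bot hjK]
    linarith

/-- Backward accumulation of a geometric source: `δ_K ≤ 0`, `δ_j ≤ δ_{j+1} + s θ^j` (`0 ≤ θ < 1`, `0 ≤ s`) ⇒
`δ_j ≤ (s/(1−θ)) θ^j` for `j ≤ K` (`geom_sum_Ico_le_of_lt_one`). [folklore] -/
theorem backward_geom {K : ℕ} {δ : ℕ → ℝ} {s θ : ℝ} (hθ0 : 0 ≤ θ) (hθ1 : θ < 1) (hs : 0 ≤ s)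
    (hK : δ K ≤ 0) (hrec : ∀ j, j < K → δ j ≤ δ (j + 1) + s * θ ^ j) :
    ∀ j, j ≤ K → δ j ≤ s / (1 - θ) * θ ^ j := by
  intro j hj
  calc δ j ≤ ∑ i ∈ Ico j K, s * θ ^ i := backward_sum hK hrec j hj
    _ = s * ∑ i ∈ Ico j K, θ ^ i := by rw [Finset.mul_sum]
    _ ≤ s * (θ ^ j / (1 - θ)) := mul_le_mul_of_nonneg_left (geom_sum_Ico_le_of_lt_one hθ0 hθ1) hs
    _ = s / (1 - θ) * θ ^ j := by ring

/-- BACKWARD DISCRETE GRÖNWALL (the node text's "∏(1 + O(g_i²))" mechanism, abstractly): `δ ≥ 0`, `δ_K = 0`,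
`δ_j ≤ δ_{j+1} + e_j + ℓ_j δ_j` with `e_j ≥ 0`, `0 ≤ ℓ_j ≤ ½` ⇒ `δ_j ≤ ∏_{m∈[j,K)} (1 + 2ℓ_m) · Σ_{i∈[j,K)} e_i` for
`j ≤ K` (absorb: `(1 − ℓ)δ ≤ δ′ + e` and `1/(1−ℓ) ≤ 1 + 2ℓ` for `ℓ ≤ ½`; descending induction). [folklore] -/
theorem backward_gronwall {K : ℕ} {δ e ℓ : ℕ → ℝ} (hδ : ∀ j, 0 ≤ δ j) (he : ∀ j, 0 ≤ e j)
    (hℓ0 : ∀ j, 0 ≤ ℓ j) (hℓ1 : ∀ j, ℓ j ≤ 1 / 2) (hK : δ K = 0)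
    (hrec : ∀ j, j < K → δ j ≤ δ (j + 1) + e j + ℓ j * δ j) :
    ∀ j, j ≤ K → δ j ≤ (∏ m ∈ Ico j K, (1 + 2 * ℓ m)) * ∑ i ∈ Ico j K, e i := by
  suffices H : ∀ d j, j + d = K → δ j ≤ (∏ m ∈ Ico j K, (1 + 2 * ℓ m)) * ∑ i ∈ Ico j K, e i from
    fun j hj => H (K - j) j (Nat.add_sub_cancel' hj)
  intro d
  induction d with
  | zero => intro j hj; rw [add_zero] at hj; subst hj; simp [hK]
  | succ d ih =>
    intro j hj
    have hjK : j < K := by omega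
    have h1 := hrec j hjK
    have h2 := ih (j + 1) (by omega)
    set P := ∏ m ∈ Ico (j + 1) K, (1 + 2 * ℓ m) with hP
    set E := ∑ i ∈ Ico (j + 1) K, e i with hE
    have hP1 : 1 ≤ P := Finset.one_le_prod fun m _ => by linarith [hℓ0 m]
    have hE0 : 0 ≤ E := Finset.sum_nonneg fun i _ => he i
    rw [Finset.prod_eq_prod_Ico_succ_bot hjK, Finset.sum_eq_sum_Ico_succ_bot hjK]
    have hlj0 := hℓ0 j
    have hlj1 := hℓ1 j
    have key : δ j ≤ (1 + 2 * ℓ j) * (δ (j + 1) + e j) := by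
      have hA : (1 - ℓ j) * δ j ≤ δ (j + 1) + e j := by nlinarith
      have hB : δ j ≤ (1 + 2 * ℓ j) * ((1 - ℓ j) * δ j) := by
        have : 0 ≤ ℓ j * (1 - 2 * ℓ j) * δ j := mul_nonneg (mul_nonneg hlj0 (by linarith)) (hδ j)
        nlinarith
      exact hB.trans (mul_le_mul_of_nonneg_left hA (by linarith))
    calc δ j ≤ (1 + 2 * ℓ j) * (δ (j + 1) + e j) := key
      _ ≤ (1 + 2 * ℓ j) * (P * E + e j) := by gcongr
      _ ≤ (1 + 2 * ℓ j) * (P * (e j + E)) := by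
          refine mul_le_mul_of_nonneg_left ?_ (by linarith)
          nlinarith [he j]
      _ = (1 + 2 * ℓ j) * P * (e j + E) := by ring

/-- The Grönwall product is at most exponential in the sum: `∏_{m∈[j,K)} (1 + 2ℓ_m) ≤ exp(2 Σ_{m∈[j,K)} ℓ_m)` for `ℓ ≥ 0`
(`Real.prod_one_add_le_exp_sum`).  With `ℓ_m = O(g_m³)` summable along asymptotically free runs (§4) this is a
K-UNIFORM constant; with the cruder `ℓ_m ≤ a·A/(m+1)` it is the polynomial `e^{aA}K^{aA}` of
`T4CauchySum.prod_one_add_mul_le_exp_mul_rpow`. [folklore] -/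
theorem prod_one_add_two_mul_le_exp {ℓ : ℕ → ℝ} (hℓ0 : ∀ j, 0 ≤ ℓ j) (j K : ℕ) :
    ∏ m ∈ Ico j K, (1 + 2 * ℓ m) ≤ Real.exp (2 * ∑ m ∈ Ico j K, ℓ m) := by
  rw [Finset.mul_sum]
  exact Real.prod_one_add_le_exp_sum _ fun m => by linarith [hℓ0 m]

/-- THE TWO-SIDED KERNEL (fading-memory feedback): for `0 < θ < 1`, `c, C ≥ 0`, `δ ≥ 0` with `δ_K = 0`, weights
`u_i ≥ 0` (`i ≤ K`) with `Σ_{i≤K} u_i ≤ U`, the SMALLNESS `C·U ≤ (1−θ)/2`, and the recursion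
`δ_j ≤ δ_{j+1} + c θ^j + C Σ_{i≤j} θ^{j−i} u_i δ_i` (`j < K`; unknowns on BOTH sides of j), one has
`δ_j ≤ (2c/(1−θ)) θ^j` for every `j ≤ K` — constant independent of `K`.  Proof: with the weighted maximum
`M = max_{i≤K} δ_i θ^{−i}` the feedback is `≤ C U M θ^j`; `backward_geom` gives `δ_j ≤ ((c + CUM)/(1−θ)) θ^j`; at the
maximiser `M ≤ (c + CUM)/(1−θ)`, and the smallness absorbs `M`. [folklore] -/
theorem twoSided_fixedPoint {K : ℕ} {δ u : ℕ → ℝ} {θ c C U : ℝ} (hθ0 : 0 < θ) (hθ1 : θ < 1)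
    (hc : 0 ≤ c) (hC : 0 ≤ C) (hδ : ∀ j, 0 ≤ δ j) (hu : ∀ i, i ≤ K → 0 ≤ u i)
    (hU : ∑ i ∈ range (K + 1), u i ≤ U) (hsmall : C * U ≤ (1 - θ) / 2) (hK : δ K = 0)
    (hrec : ∀ j, j < K →
      δ j ≤ δ (j + 1) + c * θ ^ j + C * ∑ i ∈ range (j + 1), θ ^ (j - i) * u i * δ i) :
    ∀ j, j ≤ K → δ j ≤ 2 * c / (1 - θ) * θ ^ j := by
  have hne : (range (K + 1)).Nonempty := ⟨0, by simp⟩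
  set M := (range (K + 1)).sup' hne (fun i => δ i / θ ^ i) with hM
  have hMi : ∀ i, i ≤ K → δ i ≤ M * θ ^ i := by
    intro i hi
    have h : δ i / θ ^ i ≤ M :=
      Finset.le_sup' (fun i => δ i / θ ^ i) (Finset.mem_range.mpr (Nat.lt_succ_of_le hi))
    rwa [div_le_iff₀ (pow_pos hθ0 i)] at h
  have hM0 : 0 ≤ M := by
    have h : δ 0 / θ ^ 0 ≤ M :=
      Finset.le_sup' (fun i => δ i / θ ^ i) (Finset.mem_range.mpr (Nat.succ_pos K))
    have : (0 : ℝ) ≤ δ 0 / θ ^ 0 := by simpa using hδ 0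
    exact this.trans h
  have hU0 : 0 ≤ U := (Finset.sum_nonneg fun i hi => hu i (Nat.lt_succ_iff.mp (mem_range.mp hi))).trans hU
  have hrec' : ∀ j, j < K → δ j ≤ δ (j + 1) + (c + C * U * M) * θ ^ j := by
    intro j hj
    have hsum : ∑ i ∈ range (j + 1), θ ^ (j - i) * u i * δ i ≤ θ ^ j * U * M := by
      calc ∑ i ∈ range (j + 1), θ ^ (j - i) * u i * δ i
          ≤ ∑ i ∈ range (j + 1), θ ^ (j - i) * u i * (M * θ ^ i) := by
            refine Finset.sum_le_sum fun i hi => ?_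
            have hi' : i ≤ K := by have := Finset.mem_range.mp hi; omega
            exact mul_le_mul_of_nonneg_left (hMi i hi') (mul_nonneg (pow_nonneg hθ0.le _) (hu i hi'))
        _ = θ ^ j * M * ∑ i ∈ range (j + 1), u i := by
            rw [Finset.mul_sum]
            refine Finset.sum_congr rfl fun i hi => ?_
            have hi' : i ≤ j := Nat.lt_succ_iff.mp (Finset.mem_range.mp hi)
            have hθ : θ ^ (j - i) * θ ^ i = θ ^ j := by rw [← pow_add, Nat.sub_add_cancel hi']
            calc θ ^ (j - i) * u i * (M * θ ^ i) = (θ ^ (j - i) * θ ^ i) * M * u i := by ring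
              _ = θ ^ j * M * u i := by rw [hθ]
        _ ≤ θ ^ j * M * U := by
            refine mul_le_mul_of_nonneg_left ?_ (mul_nonneg (pow_nonneg hθ0.le _) hM0)
            calc ∑ i ∈ range (j + 1), u i ≤ ∑ i ∈ range (K + 1), u i :=
                  Finset.sum_le_sum_of_subset_of_nonneg (Finset.range_mono (by omega))
                    (fun i hi _ => hu i (Nat.lt_succ_iff.mp (mem_range.mp hi)))
              _ ≤ U := hU
        _ = θ ^ j * U * M := by ring
    have h1 := hrec j hj
    have h2 := mul_le_mul_of_nonneg_left hsum hC
    nlinarith [h1, h2]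
  have hs : 0 ≤ c + C * U * M := by positivity
  have hb := backward_geom hθ0.le hθ1 hs (le_of_eq hK) hrec'
  obtain ⟨i₀, hi₀, hMi₀⟩ := Finset.exists_mem_eq_sup' hne (fun i => δ i / θ ^ i)
  have hi₀K : i₀ ≤ K := Nat.lt_succ_iff.mp (Finset.mem_range.mp hi₀)
  have h1θ : 0 < 1 - θ := by linarith
  have hMle : M ≤ (c + C * U * M) / (1 - θ) := by
    calc M = δ i₀ / θ ^ i₀ := hMi₀
      _ ≤ (c + C * U * M) / (1 - θ) := by
          rw [div_le_iff₀ (pow_pos hθ0 i₀)]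
          exact hb i₀ hi₀K
  have hMle' : M * (1 - θ) ≤ c + C * U * M := (le_div_iff₀ h1θ).mp hMle
  have hMfin : M ≤ 2 * c / (1 - θ) := by
    rw [le_div_iff₀ h1θ]
    nlinarith [hsmall, hM0, mul_le_mul_of_nonneg_right hsmall hM0]
  intro j hj
  calc δ j ≤ M * θ ^ j := hMi j hj
    _ ≤ 2 * c / (1 - θ) * θ ^ j := mul_le_mul_of_nonneg_right hMfin (pow_nonneg hθ0.le _)


/-! ## §3 The coupling matching of two IR-pinned runs of (0.20) -/

/-- The COUPLING DISCREPANCY of node U2 in the variable x = 1/g² of (0.20): run A's scale `j` against run B's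
infrared-matched scale `j + 1`, `disc gA gB j = |1/(g^A_j)² − 1/(g^B_{j+1})²|`. [cite: Balaban1987RG1, (0.20) p.256] -/
noncomputable def disc (gA gB : ℕ → ℝ) (j : ℕ) : ℝ := |1 / (gA j) ^ 2 - 1 / (gB (j + 1)) ^ 2|

/-- `disc ≥ 0`. [folklore] -/
theorem disc_nonneg (gA gB : ℕ → ℝ) (j : ℕ) : 0 ≤ disc gA gB j := abs_nonneg _

/-- From the recursion variable back to the coupling: for `a, b > 0`, `|a − b| ≤ a²·b·|1/a² − 1/b²|` (since
`1/a² − 1/b² = (b − a)(b + a)/(a²b²)` and `(a + b)/b ≥ 1`).  The weight `a²b = O(g³)` — not `γ·g²` — is what makes the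
feedback summable along asymptotically free runs (§4). [folklore] -/
theorem abs_sub_le_of_inv_sq {a b : ℝ} (ha : 0 < a) (hb : 0 < b) :
    |a - b| ≤ a ^ 2 * b * |1 / a ^ 2 - 1 / b ^ 2| := by
  have e : 1 / a ^ 2 - 1 / b ^ 2 = (b - a) * ((b + a) / (a ^ 2 * b ^ 2)) := by
    field_simp
    ring
  rw [e, abs_mul, abs_of_pos (by positivity : 0 < (b + a) / (a ^ 2 * b ^ 2)), abs_sub_comm b a]
  have e2 : a ^ 2 * b * (|a - b| * ((b + a) / (a ^ 2 * b ^ 2))) = |a - b| * ((b + a) / b) := by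
    field_simp
  rw [e2]
  have h1 : 1 ≤ (b + a) / b := by
    rw [le_div_iff₀ hb]
    linarith
  calc |a - b| = |a - b| * 1 := (mul_one _).symm
    _ ≤ |a - b| * ((b + a) / b) := mul_le_mul_of_nonneg_left h1 (abs_nonneg _)

/-- Dropping the finest coupling of run B's prefix: `Fin.tail (g_0, …, g_{k+1}) = (g_1, …, g_{k+1})`, the prefix of the
shifted sequence `n ↦ g (n+1)`. [folklore] -/
theorem tail_prefixOf (g : ℕ → ℝ) (k : ℕ) :
    Fin.tail (prefixOf g (k + 1)) = prefixOf (fun n => g (n + 1)) k := by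
  funext i
  simp [Fin.tail, prefixOf]

/-- A run whose couplings up to scale `N` lie in ]0,γ] has all its prefixes `k ≤ N` in the boxes. [folklore] -/
theorem prefixOf_mem_box {γ : ℝ} {g : ℕ → ℝ} {N k : ℕ} (hk : k ≤ N)
    (hg : ∀ i, i ≤ N → 0 < g i ∧ g i ≤ γ) : prefixOf g k ∈ Box γ k :=
  mem_box.mpr fun i => by
    have hi : (i : ℕ) ≤ N := by have := i.isLt; omega
    simpa using hg i hi

/-- THE INFRARED PIN: both runs end at the renormalized coupling, `g^A_K = g^B_{K+1}` (the renormalization condition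
`g_K = g` of Theorem 2 p. 259 for each run), so `disc gA gB K = 0`. [cite: Balaban1987RG1, Thm 2 p.259] -/
theorem disc_pin {gA gB : ℕ → ℝ} {K : ℕ} (hpin : gA K = gB (K + 1)) : disc gA gB K = 0 := by
  simp [disc, hpin]

/-- THE BACKWARD COUPLING-MATCHING RECURSION (node U2; (0.20) for both runs + NE4 + history moduli): for `j < K`,
`δ_j ≤ δ_{j+1} + c θ^j + Σ_{i≤j} Λ j i · (g^A_i)² g^B_{i+1} · δ_i`, where `δ = disc gA gB`: subtract (0.20) of run A
at step j from (0.20) of run B at step j + 1; the β-difference splits into the SCALE SHIFT at B's couplings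
(`ScaleShiftRate`, ≤ cθ^j) and the HISTORY SHIFT at scale j (`HistLipschitz`, then `abs_sub_le_of_inv_sq`
coordinatewise).  Hypotheses, never facts: `RGEqH` for both runs (printed recursion), couplings in ]0,γ], the two §1
shapes. [cite: Balaban1987RG1, (0.20) p.256] -/
theorem disc_step {β : HBeta} {γ c θ : ℝ} {Λ : ℕ → ℕ → ℝ} {K : ℕ} {gA gB : ℕ → ℝ}
    (hA : RGEqH K β gA) (hB : RGEqH (K + 1) β gB)
    (hAbox : ∀ i, i ≤ K → 0 < gA i ∧ gA i ≤ γ) (hBbox : ∀ i, i ≤ K + 1 → 0 < gB i ∧ gB i ≤ γ)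
    (hS : ScaleShiftRate c θ γ β) (hL : HistLipschitz Λ γ β) (hΛ : ∀ k i, i ≤ k → 0 ≤ Λ k i)
    {j : ℕ} (hj : j < K) :
    disc gA gB j ≤ disc gA gB (j + 1) + c * θ ^ j
      + ∑ i ∈ range (j + 1), Λ j i * ((gA i) ^ 2 * gB (i + 1)) * disc gA gB i := by
  have eA := hA j hj
  have eB := hB (j + 1) (by omega)
  have hwbox : prefixOf gB (j + 1) ∈ Box γ (j + 1) := prefixOf_mem_box (by omega) hBbox
  have hpA : prefixOf gA j ∈ Box γ j := prefixOf_mem_box hj.le hAbox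
  have htail : Fin.tail (prefixOf gB (j + 1)) ∈ Box γ j := by
    rw [tail_prefixOf]
    exact prefixOf_mem_box (N := K) hj.le fun i hi => hBbox (i + 1) (by omega)
  have h1 := hS j (prefixOf gB (j + 1)) hwbox
  have h2 := hL j (Fin.tail (prefixOf gB (j + 1))) (prefixOf gA j) htail hpA
  have h3 : ∑ i : Fin (j + 1), Λ j i * |Fin.tail (prefixOf gB (j + 1)) i - prefixOf gA j i|
      ≤ ∑ i ∈ range (j + 1), Λ j i * ((gA i) ^ 2 * gB (i + 1)) * disc gA gB i := by
    rw [Finset.sum_range (fun i => Λ j i * ((gA i) ^ 2 * gB (i + 1)) * disc gA gB i)]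
    refine Finset.sum_le_sum fun i _ => ?_
    have hiK : (i : ℕ) ≤ K := by have := i.isLt; omega
    have hgA := hAbox i hiK
    have hgB := hBbox (i + 1) (by omega)
    simp only [Fin.tail, prefixOf_apply, Fin.val_succ]
    rw [abs_sub_comm, mul_assoc]
    exact mul_le_mul_of_nonneg_left (abs_sub_le_of_inv_sq hgA.1 hgB.1)
      (hΛ j i (Nat.lt_succ_iff.mp i.isLt))
  have key : 1 / gA j ^ 2 - 1 / gB (j + 1) ^ 2
      = (1 / gA (j + 1) ^ 2 - 1 / gB (j + 1 + 1) ^ 2)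
        + (β j (prefixOf gA j) - β j (Fin.tail (prefixOf gB (j + 1))))
        - (β (j + 1) (prefixOf gB (j + 1)) - β j (Fin.tail (prefixOf gB (j + 1)))) := by
    rw [eA, eB]
    ring
  have habs : disc gA gB j ≤ disc gA gB (j + 1)
      + |β j (prefixOf gA j) - β j (Fin.tail (prefixOf gB (j + 1)))|
      + |β (j + 1) (prefixOf gB (j + 1)) - β j (Fin.tail (prefixOf gB (j + 1)))| := by
    simp only [disc]
    rw [key]
    exact (abs_sub _ _).trans (add_le_add (abs_add_le _ _) le_rfl)
  have hcomm : |β j (prefixOf gA j) - β j (Fin.tail (prefixOf gB (j + 1)))|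
      = |β j (Fin.tail (prefixOf gB (j + 1))) - β j (prefixOf gA j)| := abs_sub_comm _ _
  linarith [habs, hcomm, h1, h2, h3]

/-- **NODE U2, MAIN FORM (fading memory; K-UNIFORM constant).**  Two runs of (0.20) with the SAME history-dependent
family `β` — A: `K` steps, B: `K + 1` steps — all couplings in ]0,γ], pinned `g^A_K = g^B_{K+1}`; NE4 as
`ScaleShiftRate c θ γ β`; history moduli `HistLipschitz Λ γ β` with `FadingMemory C θ Λ`; the AF weight bound
`Σ_{i≤K} (g^A_i)² g^B_{i+1} ≤ U` (§4: `U = γ³ + 2γ/b` under a lower bound `b ≤ β`); SMALLNESS `C·U ≤ (1−θ)/2`.  THEN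
`|1/(g^A_j)² − 1/(g^B_{j+1})²| ≤ (2c/(1−θ)) θ^j` for every `j ≤ K`.  Every hypothesis about `β` is an UNPRINTED input
(cell NE4 / GAPS G-t4-U2-1, G-t4-U2-2, G-pv16-2); the theorem is bookkeeping (`disc_step` + `twoSided_fixedPoint`).
[cite: Balaban1987RG1, (0.20) p.256 and §5 p.298] -/
theorem disc_le_of_fadingMemory {β : HBeta} {γ c θ C U : ℝ} {Λ : ℕ → ℕ → ℝ} {K : ℕ}
    {gA gB : ℕ → ℝ} (hθ0 : 0 < θ) (hθ1 : θ < 1) (hc : 0 ≤ c) (hC : 0 ≤ C)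
    (hA : RGEqH K β gA) (hB : RGEqH (K + 1) β gB)
    (hAbox : ∀ i, i ≤ K → 0 < gA i ∧ gA i ≤ γ) (hBbox : ∀ i, i ≤ K + 1 → 0 < gB i ∧ gB i ≤ γ)
    (hpin : gA K = gB (K + 1))
    (hS : ScaleShiftRate c θ γ β) (hL : HistLipschitz Λ γ β) (hΛ : FadingMemory C θ Λ)
    (hU : ∑ i ∈ range (K + 1), (gA i) ^ 2 * gB (i + 1) ≤ U) (hsmall : C * U ≤ (1 - θ) / 2) :
    ∀ j, j ≤ K → disc gA gB j ≤ 2 * c / (1 - θ) * θ ^ j := by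
  have hu : ∀ i, i ≤ K → 0 ≤ (gA i) ^ 2 * gB (i + 1) := fun i hi =>
    mul_nonneg (sq_nonneg _) (hBbox (i + 1) (by omega)).1.le
  refine twoSided_fixedPoint (u := fun i => (gA i) ^ 2 * gB (i + 1)) hθ0 hθ1 hc hC
    (disc_nonneg gA gB) hu hU hsmall (disc_pin hpin) ?_
  intro j hj
  have hstep := disc_step hA hB hAbox hBbox hS hL (fun k i hik => (hΛ k i hik).1) hj
  have hsum : ∑ i ∈ range (j + 1), Λ j i * ((gA i) ^ 2 * gB (i + 1)) * disc gA gB i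
      ≤ C * ∑ i ∈ range (j + 1), θ ^ (j - i) * ((gA i) ^ 2 * gB (i + 1)) * disc gA gB i := by
    rw [Finset.mul_sum]
    refine Finset.sum_le_sum fun i hi => ?_
    have hij : i ≤ j := Nat.lt_succ_iff.mp (mem_range.mp hi)
    have hiK : i ≤ K := by omega
    have hnn : 0 ≤ (gA i) ^ 2 * gB (i + 1) * disc gA gB i := mul_nonneg (hu i hiK) (disc_nonneg _ _ _)
    calc Λ j i * ((gA i) ^ 2 * gB (i + 1)) * disc gA gB i
        = Λ j i * ((gA i) ^ 2 * gB (i + 1) * disc gA gB i) := by ring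
      _ ≤ C * θ ^ (j - i) * ((gA i) ^ 2 * gB (i + 1) * disc gA gB i) :=
          mul_le_mul_of_nonneg_right (hΛ j i hij).2 hnn
      _ = C * (θ ^ (j - i) * ((gA i) ^ 2 * gB (i + 1)) * disc gA gB i) := by ring
  linarith [hstep, hsum]

/-- **NODE U2, THE NODE TEXT'S LITERAL GRÖNWALL FORM (Markov-type feedback; no smallness beyond `Lγ³ ≤ ½`).**  Same two
pinned runs; NE4 as `ScaleShiftRate c θ γ β` (`0 ≤ θ < 1`); feedback through the last coupling only,
`LastOnlyLipschitz L γ β`.  THEN for `j ≤ K`: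
`|1/(g^A_j)² − 1/(g^B_{j+1})²| ≤ exp(2 Σ_{m∈[j,K)} L (g^A_m)² g^B_{m+1}) · (c/(1−θ)) θ^j` — the product of the one-step
Lipschitz factors "∏(1 + O(g_m²))" of T4-DAG §2 U2 in exponential form; by §4 the exponent is ≤ 2L(γ³ + 2γ/b) along
asymptotically free runs (K-uniform), and by `T4CauchySum` §4 it is O(log K) under the mere logarithmic running bound
(polynomial K^c).  Bookkeeping (`disc_step` with the diagonal modulus + `backward_gronwall`). [cite: Balaban1987RG1, (0.20) p.256] -/
theorem disc_le_of_lastOnly {β : HBeta} {γ c θ L : ℝ} {K : ℕ} {gA gB : ℕ → ℝ}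
    (hθ0 : 0 ≤ θ) (hθ1 : θ < 1) (hc : 0 ≤ c) (hL0 : 0 ≤ L) (hLγ : L * γ ^ 3 ≤ 1 / 2)
    (hA : RGEqH K β gA) (hB : RGEqH (K + 1) β gB)
    (hAbox : ∀ i, i ≤ K → 0 < gA i ∧ gA i ≤ γ) (hBbox : ∀ i, i ≤ K + 1 → 0 < gB i ∧ gB i ≤ γ)
    (hpin : gA K = gB (K + 1))
    (hS : ScaleShiftRate c θ γ β) (hLip : LastOnlyLipschitz L γ β) :
    ∀ j, j ≤ K → disc gA gB j
      ≤ Real.exp (2 * ∑ m ∈ Ico j K, L * ((gA m) ^ 2 * gB (m + 1))) * (c / (1 - θ) * θ ^ j) := by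
  -- the last-only modulus as history moduli concentrated on the diagonal
  set Λ : ℕ → ℕ → ℝ := fun k i => if i = k then L else 0 with hΛdef
  have hHL : HistLipschitz Λ γ β := by
    intro k p q hp hq
    have h := hLip k p q hp hq
    have e : ∑ i : Fin (k + 1), Λ k i * |p i - q i| = L * |p (Fin.last k) - q (Fin.last k)| := by
      rw [Finset.sum_eq_single (Fin.last k)]
      · simp [hΛdef]
      · intro i _ hi
        have : (i : ℕ) ≠ k := fun h' => hi (Fin.ext (by simp [h']))
        simp [hΛdef, this]
      · simp
    rw [e]
    exact h
  have hΛ0 : ∀ k i, i ≤ k → 0 ≤ Λ k i := fun k i _ => by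
    simp only [hΛdef]
    split_ifs <;> linarith
  -- truncated sequences for the abstract Grönwall lemma
  set δ : ℕ → ℝ := fun j => if j ≤ K then disc gA gB j else 0 with hδdef
  set ℓ : ℕ → ℝ := fun j => if j < K then L * ((gA j) ^ 2 * gB (j + 1)) else 0 with hℓdef
  have hδ0 : ∀ j, 0 ≤ δ j := fun j => by
    simp only [hδdef]
    split_ifs
    · exact disc_nonneg _ _ _
    · exact le_rfl
  have hu : ∀ j, j < K → 0 ≤ (gA j) ^ 2 * gB (j + 1) ∧ (gA j) ^ 2 * gB (j + 1) ≤ γ ^ 3 := by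
    intro j hj
    have hgA := hAbox j hj.le
    have hgB := hBbox (j + 1) (by omega)
    refine ⟨mul_nonneg (sq_nonneg _) hgB.1.le, ?_⟩
    have h1 : (gA j) ^ 2 ≤ γ ^ 2 := pow_le_pow_left₀ hgA.1.le hgA.2 2
    calc (gA j) ^ 2 * gB (j + 1) ≤ γ ^ 2 * γ :=
          mul_le_mul h1 hgB.2 hgB.1.le (sq_nonneg _)
      _ = γ ^ 3 := by ring
  have hℓ0 : ∀ j, 0 ≤ ℓ j := fun j => by
    simp only [hℓdef]
    split_ifs with hj
    · exact mul_nonneg hL0 (hu j hj).1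
    · exact le_rfl
  have hℓ1 : ∀ j, ℓ j ≤ 1 / 2 := fun j => by
    simp only [hℓdef]
    split_ifs with hj
    · calc L * ((gA j) ^ 2 * gB (j + 1)) ≤ L * γ ^ 3 := mul_le_mul_of_nonneg_left (hu j hj).2 hL0
        _ ≤ 1 / 2 := hLγ
    · linarith
  have hK : δ K = 0 := by simp [hδdef, disc_pin hpin]
  have hrec : ∀ j, j < K → δ j ≤ δ (j + 1) + c * θ ^ j + ℓ j * δ j := by
    intro j hj
    have hstep := disc_step hA hB hAbox hBbox hS hHL hΛ0 hj
    have e : ∑ i ∈ range (j + 1), Λ j i * ((gA i) ^ 2 * gB (i + 1)) * disc gA gB i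
        = L * ((gA j) ^ 2 * gB (j + 1)) * disc gA gB j := by
      rw [Finset.sum_eq_single j]
      · simp [hΛdef]
      · intro i _ hi
        simp [hΛdef, hi]
      · simp
    rw [e] at hstep
    have hδj : δ j = disc gA gB j := by simp [hδdef, hj.le]
    have hδj1 : δ (j + 1) = disc gA gB (j + 1) := by simp [hδdef, Nat.succ_le_of_lt hj]
    have hℓj : ℓ j = L * ((gA j) ^ 2 * gB (j + 1)) := by simp [hℓdef, hj]
    rw [hδj, hδj1, hℓj]
    exact hstep
  have hG := backward_gronwall hδ0 (fun j => mul_nonneg hc (pow_nonneg hθ0 j)) hℓ0 hℓ1 hK hrec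
  intro j hj
  have h := hG j hj
  have hδj : δ j = disc gA gB j := by simp [hδdef, hj]
  rw [hδj] at h
  have hprod : ∏ m ∈ Ico j K, (1 + 2 * ℓ m)
      ≤ Real.exp (2 * ∑ m ∈ Ico j K, L * ((gA m) ^ 2 * gB (m + 1))) := by
    have e : ∑ m ∈ Ico j K, L * ((gA m) ^ 2 * gB (m + 1)) = ∑ m ∈ Ico j K, ℓ m :=
      Finset.sum_congr rfl fun m hm => by simp [hℓdef, (Finset.mem_Ico.mp hm).2]
    rw [e]
    exact prod_one_add_two_mul_le_exp hℓ0 j K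
  have hgeom : ∑ i ∈ Ico j K, c * θ ^ i ≤ c / (1 - θ) * θ ^ j := by
    rw [← Finset.mul_sum]
    calc c * ∑ i ∈ Ico j K, θ ^ i ≤ c * (θ ^ j / (1 - θ)) :=
          mul_le_mul_of_nonneg_left (geom_sum_Ico_le_of_lt_one hθ0 hθ1) hc
      _ = c / (1 - θ) * θ ^ j := by ring
  have hsum0 : 0 ≤ ∑ i ∈ Ico j K, c * θ ^ i := Finset.sum_nonneg fun i _ => mul_nonneg hc (pow_nonneg hθ0 i)
  calc disc gA gB j ≤ (∏ m ∈ Ico j K, (1 + 2 * ℓ m)) * ∑ i ∈ Ico j K, c * θ ^ i := h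
    _ ≤ Real.exp (2 * ∑ m ∈ Ico j K, L * ((gA m) ^ 2 * gB (m + 1))) * (c / (1 - θ) * θ ^ j) :=
        mul_le_mul hprod hgeom hsum0 (Real.exp_pos _).le

/-! ## §4 Where asymptotic freedom enters: the weights `(g^A_i)² g^B_{i+1}` are summable along AF runs -/

/-- HYPOTHESIS SHAPE (v1.1): an EVENTUAL lower bound `b ≤ β_{k+1}` on the ]0,γ]-boxes, for the scales `k ≥ k₀`
only.  This is the form the β-cell's limit-form analysis delivers — `Beta.Assembly.LimitForm.tail_lower :
∀ k, k₀ ≤ k → ∀ v ∈ Box γ₁ k, β⁰_∞/2 ≤ β k v` (from the cell's OPEN analytic inputs (AF-0r)/(AF-0∞)/(AF-1), rows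
an1–an4; module not imported here) — whereas the all-k form `FlowStep.BetaLowerH b γ β` (= the case `k₀ = 0`,
`eventualLowerH_of_betaLowerH`) is, given the limit form, equivalent to an additional finite list of small-k SIGNS
(`Beta.Assembly.LimitForm.exists_uniform_beta0_lower`), an input node U2 can do without: the weights of the first `k₀`
scales are bounded by `γ³` each (`sum_weights_le_of_eventualLower`).  NOT PRINTED ([Balaban1989LargeFieldII] p. 355:
the paper on the β-function "has not been published yet"); consumed only as a hypothesis. [cite: Balaban1987RG1, (0.31) p.259] -/
def EventualLowerH (b γ : ℝ) (k₀ : ℕ) (β : HBeta) : Prop := ∀ k v, k₀ ≤ k → v ∈ Box γ k → b ≤ β k v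

/-- The all-k lower bound is the eventual one from any `k₀` (in particular `k₀ = 0`). [folklore] -/
theorem eventualLowerH_of_betaLowerH {b γ : ℝ} {β : HBeta} (h : BetaLowerH b γ β) (k₀ : ℕ) :
    EventualLowerH b γ k₀ β := fun k v _ hv => h k v hv

/-- `BetaLowerH b γ β ↔ EventualLowerH b γ 0 β`. [folklore] -/
theorem betaLowerH_iff_eventualLowerH_zero {b γ : ℝ} {β : HBeta} : BetaLowerH b γ β ↔ EventualLowerH b γ 0 β :=
  ⟨fun h => eventualLowerH_of_betaLowerH h 0, fun h k v hv => h k v (Nat.zero_le k) hv⟩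

/-- WHERE ASYMPTOTIC FREEDOM ENTERS (discrete lower half of (0.31) along one run, from scale `k₀` on): an eventual
lower bound `b ≤ β_{m+1}` on the boxes for `m ≥ k₀` (`EventualLowerH b γ k₀ β` — UNPRINTED input, see above) and
couplings in ]0,γ] give `1/g_K² + b(K − i) ≤ 1/g_i²` for `k₀ ≤ i ≤ K` (`FlowStep.inv_sq_telescopeH`).
[cite: Balaban1987RG1, (0.31) p.259] -/
theorem inv_sq_lower_of_eventualLower {β : HBeta} {γ b : ℝ} {k₀ K : ℕ} {g : ℕ → ℝ} (h : RGEqH K β g)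
    (hbox : ∀ i, i ≤ K → 0 < g i ∧ g i ≤ γ) (hlo : EventualLowerH b γ k₀ β) {i : ℕ} (hk : k₀ ≤ i) (hi : i ≤ K) :
    1 / (g K) ^ 2 + b * ((K - i : ℕ) : ℝ) ≤ 1 / (g i) ^ 2 := by
  rw [inv_sq_telescopeH h hi le_rfl]
  have hsum := Finset.card_nsmul_le_sum (Ico i K) (fun m => β m (prefixOf g m)) b
    (fun m hm => hlo m _ (hk.trans (Finset.mem_Ico.mp hm).1)
      (prefixOf_mem_box (Finset.mem_Ico.mp hm).2.le hbox))
  rw [Nat.card_Ico, nsmul_eq_mul] at hsum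
  linarith

/-- WHERE ASYMPTOTIC FREEDOM ENTERS (discrete lower half of (0.31) along one run): a lower bound `b ≤ β_{m+1}` on the
boxes (`FlowStep.BetaLowerH b γ β` — the cell's typed UNPRINTED input T09.F; [Balaban1989LargeFieldII] p. 355 "has
not been published yet") and couplings in ]0,γ] give `1/g_K² + b(K − i) ≤ 1/g_i²` for `i ≤ K`
(`FlowStep.inv_sq_telescopeH`; the case `k₀ = 0` of `inv_sq_lower_of_eventualLower`). [cite: Balaban1987RG1, (0.31) p.259] -/
theorem inv_sq_lower_of_betaLower {β : HBeta} {γ b : ℝ} {K : ℕ} {g : ℕ → ℝ} (h : RGEqH K β g)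
    (hbox : ∀ i, i ≤ K → 0 < g i ∧ g i ≤ γ) (hlo : BetaLowerH b γ β) {i : ℕ} (hi : i ≤ K) :
    1 / (g K) ^ 2 + b * ((K - i : ℕ) : ℝ) ≤ 1 / (g i) ^ 2 :=
  inv_sq_lower_of_eventualLower h hbox (eventualLowerH_of_betaLowerH hlo 0) (Nat.zero_le i) hi

/-- The square-root telescoping behind the K-uniform weight sum: for `0 < p ≤ q` with `q² − p² = b > 0`,
`(1/q²)(1/q) ≤ (2/b)(1/p − 1/q)` (i.e. `a_m^{−3/2} ≤ (2/b)(a_{m−1}^{−1/2} − a_m^{−1/2})` for `a_m = a_{m−1} + b`; the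
discrete form of `∫ (a + bt)^{−3/2} dt`). [folklore] -/
theorem inv_cube_le_telescope {p q b : ℝ} (hp : 0 < p) (hpq : p ≤ q) (hb : 0 < b)
    (h : q ^ 2 - p ^ 2 = b) : 1 / q ^ 2 * (1 / q) ≤ 2 / b * (1 / p - 1 / q) := by
  subst h
  have hq : 0 < q := lt_of_lt_of_le hp hpq
  rw [show 2 / (q ^ 2 - p ^ 2) * (1 / p - 1 / q) = 2 * (q - p) / ((q ^ 2 - p ^ 2) * p * q) by
        field_simp,
    show 1 / q ^ 2 * (1 / q) = 1 / (q ^ 2 * q) by field_simp,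
    div_le_div_iff₀ (by positivity) (by positivity)]
  nlinarith [mul_nonneg (mul_nonneg hq.le (sq_nonneg (q - p))) (by linarith : 0 ≤ 2 * q + p),
    mul_pos hp hq]

/-- The asymptotic-freedom comparison profile `a_m = 1/γ² + b·m` (a lower bound for `1/g²` at `m` scales above the
infrared end, by `inv_sq_lower_of_betaLower`). [folklore] -/
noncomputable def prof (γ b : ℝ) (m : ℕ) : ℝ := 1 / γ ^ 2 + b * m

/-- `√a_m`. [folklore] -/
noncomputable def sprof (γ b : ℝ) (m : ℕ) : ℝ := Real.sqrt (prof γ b m)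

/-- `a_m > 0`. [folklore] -/
theorem prof_pos {γ b : ℝ} (hγ : 0 < γ) (hb : 0 ≤ b) (m : ℕ) : 0 < prof γ b m := by
  unfold prof; positivity

/-- `√a_m > 0`. [folklore] -/
theorem sprof_pos {γ b : ℝ} (hγ : 0 < γ) (hb : 0 ≤ b) (m : ℕ) : 0 < sprof γ b m :=
  Real.sqrt_pos.mpr (prof_pos hγ hb m)

/-- `(√a_m)² = a_m`. [folklore] -/
theorem sprof_sq {γ b : ℝ} (hγ : 0 < γ) (hb : 0 ≤ b) (m : ℕ) : (sprof γ b m) ^ 2 = prof γ b m :=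
  Real.sq_sqrt (prof_pos hγ hb m).le

/-- `√a_m ≤ √a_{m+1}`. [folklore] -/
theorem sprof_mono {γ b : ℝ} (hb : 0 ≤ b) (m : ℕ) : sprof γ b m ≤ sprof γ b (m + 1) :=
  Real.sqrt_le_sqrt (by unfold prof; push_cast; nlinarith)

/-- `(√a_{m+1})² − (√a_m)² = b`. [folklore] -/
theorem sprof_sq_diff {γ b : ℝ} (hγ : 0 < γ) (hb : 0 ≤ b) (m : ℕ) :
    (sprof γ b (m + 1)) ^ 2 - (sprof γ b m) ^ 2 = b := by
  rw [sprof_sq hγ hb, sprof_sq hγ hb]; unfold prof; push_cast; ring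

/-- `√a_0 = 1/γ`. [folklore] -/
theorem sprof_zero {γ b : ℝ} (hγ : 0 < γ) : sprof γ b 0 = 1 / γ := by
  unfold sprof prof
  rw [Nat.cast_zero, mul_zero, add_zero, show (1 : ℝ) / γ ^ 2 = (1 / γ) ^ 2 by ring,
    Real.sqrt_sq (by positivity)]

/-- The reflected profile sum telescopes K-uniformly: `Σ_{i≤K} a_{K−i}^{−3/2} ≤ γ³ + 2γ/b` — split off `m = 0`
(`= γ³`) and telescope the rest with `inv_cube_le_telescope` (`≤ (2/b)(1/√a_0) = 2γ/b`). [folklore] -/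
theorem sum_profWeights_le {γ b : ℝ} (hγ : 0 < γ) (hb : 0 < b) (K : ℕ) :
    ∑ i ∈ range (K + 1), 1 / (sprof γ b (K - i)) ^ 2 * (1 / sprof γ b (K - i)) ≤ γ ^ 3 + 2 * γ / b := by
  have hp0 := sprof_pos hγ hb.le
  have hf0 : 1 / (sprof γ b 0) ^ 2 * (1 / sprof γ b 0) = γ ^ 3 := by
    rw [sprof_zero hγ]; simp only [one_div_pow, one_div_one_div]; ring
  calc ∑ i ∈ range (K + 1), 1 / (sprof γ b (K - i)) ^ 2 * (1 / sprof γ b (K - i))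
      = ∑ i ∈ range (K + 1), 1 / (sprof γ b (K + 1 - 1 - i)) ^ 2 * (1 / sprof γ b (K + 1 - 1 - i)) := by
        refine Finset.sum_congr rfl fun i _ => ?_
        rw [show K + 1 - 1 - i = K - i by omega]
    _ = ∑ m ∈ range (K + 1), 1 / (sprof γ b m) ^ 2 * (1 / sprof γ b m) :=
        Finset.sum_range_reflect (fun m => 1 / (sprof γ b m) ^ 2 * (1 / sprof γ b m)) (K + 1)
    _ = (∑ m ∈ range K, 1 / (sprof γ b (m + 1)) ^ 2 * (1 / sprof γ b (m + 1)))
          + 1 / (sprof γ b 0) ^ 2 * (1 / sprof γ b 0) := Finset.sum_range_succ' _ _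
    _ ≤ (∑ m ∈ range K, 2 / b * (1 / sprof γ b m - 1 / sprof γ b (m + 1))) + γ ^ 3 := by
        refine add_le_add (Finset.sum_le_sum fun m _ => ?_) hf0.le
        exact inv_cube_le_telescope (hp0 m) (sprof_mono hb.le m) hb (sprof_sq_diff hγ hb.le m)
    _ = 2 / b * (1 / sprof γ b 0 - 1 / sprof γ b K) + γ ^ 3 := by
        rw [← Finset.mul_sum, Finset.sum_range_sub' (fun m => 1 / sprof γ b m) K]
    _ ≤ 2 / b * (1 / sprof γ b 0) + γ ^ 3 := by
        have h1 : 0 ≤ 1 / sprof γ b K := (one_div_pos.mpr (hp0 K)).le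
        have h2 : 0 < 2 / b := div_pos (by norm_num) hb
        nlinarith [mul_nonneg h2.le h1]
    _ = γ ^ 3 + 2 * γ / b := by rw [sprof_zero hγ, one_div_one_div]; ring

/-- **THE AF WEIGHT SUM IS K-UNIFORM — EVENTUAL FORM (v1.1):** along two runs of (0.20) (A: K steps, B: K + 1 steps,
couplings in ]0,γ]) with an EVENTUAL trajectory-wise lower bound `b ≤ β_{m+1}` on the boxes for `m ≥ k₀`
(`EventualLowerH b γ k₀ β`, `b > 0` — UNPRINTED input, the `Beta.Assembly.LimitForm.tail_lower` shape),
`Σ_{i≤K} (g^A_i)² g^B_{i+1} ≤ (k₀ + 1)γ³ + 2γ/b`: the (at most `k₀`) weights with `i < k₀` are `≤ γ³` each by the box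
alone; for `k₀ ≤ i ≤ K`, `inv_sq_lower_of_eventualLower` gives `(g^A_i)² ≤ 1/a_{K−i}` and `g^B_{i+1} ≤ 1/√a_{K−i}`
(`a_m = 1/γ² + b·m`), and the reflected profile sum is `≤ γ³ + 2γ/b` (`sum_profWeights_le`).  K-UNIFORM, so the
fixed-point smallness of `disc_le_of_fadingMemory` does not degrade with K; no small-k sign of the β-functions is used.
[cite: Balaban1987RG1, (0.31) p.259] -/
theorem sum_weights_le_of_eventualLower {β : HBeta} {γ b : ℝ} {k₀ K : ℕ} {gA gB : ℕ → ℝ}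
    (hγ : 0 < γ) (hb : 0 < b) (hA : RGEqH K β gA) (hB : RGEqH (K + 1) β gB)
    (hAbox : ∀ i, i ≤ K → 0 < gA i ∧ gA i ≤ γ) (hBbox : ∀ i, i ≤ K + 1 → 0 < gB i ∧ gB i ≤ γ)
    (hlo : EventualLowerH b γ k₀ β) :
    ∑ i ∈ range (K + 1), (gA i) ^ 2 * gB (i + 1) ≤ ((k₀ : ℝ) + 1) * γ ^ 3 + 2 * γ / b := by
  have hp0 := sprof_pos hγ hb.le
  -- pointwise on the AF scales `k₀ ≤ i ≤ K`: u_i ≤ f (K - i) with f m = (1/p_m²)(1/p_m), p_m = √(1/γ² + b m)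
  have hpt : ∀ i, k₀ ≤ i → i ≤ K →
      (gA i) ^ 2 * gB (i + 1) ≤ 1 / (sprof γ b (K - i)) ^ 2 * (1 / sprof γ b (K - i)) := by
    intro i hk hi
    have hgA := hAbox i hi
    have hgB := hBbox (i + 1) (by omega)
    have hgAK := hAbox K le_rfl
    have hgBK := hBbox (K + 1) le_rfl
    have hAK : 1 / γ ^ 2 ≤ 1 / (gA K) ^ 2 :=
      one_div_le_one_div_of_le (pow_pos hgAK.1 2) (pow_le_pow_left₀ hgAK.1.le hgAK.2 2)
    have hBK : 1 / γ ^ 2 ≤ 1 / (gB (K + 1)) ^ 2 :=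
      one_div_le_one_div_of_le (pow_pos hgBK.1 2) (pow_le_pow_left₀ hgBK.1.le hgBK.2 2)
    have h1 := inv_sq_lower_of_eventualLower hA hAbox hlo hk hi
    have h2 := inv_sq_lower_of_eventualLower hB hBbox hlo (i := i + 1) (by omega) (by omega)
    have hKi : ((K + 1 - (i + 1) : ℕ) : ℝ) = ((K - i : ℕ) : ℝ) := by congr 1; omega
    rw [hKi] at h2
    have haA : prof γ b (K - i) ≤ 1 / (gA i) ^ 2 := by unfold prof; linarith
    have haB : prof γ b (K - i) ≤ 1 / (gB (i + 1)) ^ 2 := by unfold prof; linarith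
    have hsqA : (gA i) ^ 2 ≤ 1 / (sprof γ b (K - i)) ^ 2 := by
      rw [sprof_sq hγ hb.le, le_one_div (pow_pos hgA.1 2) (prof_pos hγ hb.le _)]
      exact haA
    have hsqB : (gB (i + 1)) ^ 2 ≤ (1 / sprof γ b (K - i)) ^ 2 := by
      rw [one_div_pow, sprof_sq hγ hb.le, le_one_div (pow_pos hgB.1 2) (prof_pos hγ hb.le _)]
      exact haB
    have hB' : gB (i + 1) ≤ 1 / sprof γ b (K - i) :=
      (pow_le_pow_iff_left₀ hgB.1.le (one_div_pos.mpr (hp0 _)).le two_ne_zero).mp hsqB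
    exact mul_le_mul hsqA hB' hgB.1.le (by positivity)
  -- pointwise on all scales: u_i ≤ γ³ by the box alone
  have hcube : ∀ i, i ≤ K → (gA i) ^ 2 * gB (i + 1) ≤ γ ^ 3 := by
    intro i hi
    have hgA := hAbox i hi
    have hgB := hBbox (i + 1) (by omega)
    calc (gA i) ^ 2 * gB (i + 1) ≤ γ ^ 2 * γ :=
          mul_le_mul (pow_le_pow_left₀ hgA.1.le hgA.2 2) hgB.2 hgB.1.le (sq_nonneg γ)
      _ = γ ^ 3 := by ring
  -- combine: u_i ≤ [i < k₀]·γ³ + f (K - i)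
  have hmaj : ∀ i ∈ range (K + 1), (gA i) ^ 2 * gB (i + 1)
      ≤ (if i < k₀ then γ ^ 3 else 0) + 1 / (sprof γ b (K - i)) ^ 2 * (1 / sprof γ b (K - i)) := by
    intro i hi
    have hi' : i ≤ K := Nat.lt_succ_iff.mp (mem_range.mp hi)
    have hf : 0 ≤ 1 / (sprof γ b (K - i)) ^ 2 * (1 / sprof γ b (K - i)) := by
      have := hp0 (K - i); positivity
    by_cases hik : i < k₀
    · rw [if_pos hik]; linarith [hcube i hi']
    · rw [if_neg hik, zero_add]; exact hpt i (not_lt.mp hik) hi'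
  have hind : ∑ i ∈ range (K + 1), (if i < k₀ then γ ^ 3 else (0 : ℝ)) ≤ (k₀ : ℝ) * γ ^ 3 := by
    rw [Finset.sum_ite, Finset.sum_const_zero, add_zero, Finset.sum_const, nsmul_eq_mul]
    have hcard : ((range (K + 1)).filter (fun i => i < k₀)).card ≤ k₀ := by
      calc ((range (K + 1)).filter (fun i => i < k₀)).card ≤ (range k₀).card :=
            Finset.card_le_card fun i hi => mem_range.mpr (Finset.mem_filter.mp hi).2
        _ = k₀ := Finset.card_range k₀
    exact mul_le_mul_of_nonneg_right (by exact_mod_cast hcard) (pow_nonneg hγ.le 3)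
  calc ∑ i ∈ range (K + 1), (gA i) ^ 2 * gB (i + 1)
      ≤ ∑ i ∈ range (K + 1),
          ((if i < k₀ then γ ^ 3 else 0) + 1 / (sprof γ b (K - i)) ^ 2 * (1 / sprof γ b (K - i))) :=
        Finset.sum_le_sum hmaj
    _ = (∑ i ∈ range (K + 1), (if i < k₀ then γ ^ 3 else (0 : ℝ)))
          + ∑ i ∈ range (K + 1), 1 / (sprof γ b (K - i)) ^ 2 * (1 / sprof γ b (K - i)) :=
        Finset.sum_add_distrib
    _ ≤ (k₀ : ℝ) * γ ^ 3 + (γ ^ 3 + 2 * γ / b) := add_le_add hind (sum_profWeights_le hγ hb K)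
    _ = ((k₀ : ℝ) + 1) * γ ^ 3 + 2 * γ / b := by ring

/-- **THE AF WEIGHT SUM IS K-UNIFORM:** along two runs of (0.20) (A: K steps, B: K + 1 steps, couplings in ]0,γ]) with a
trajectory-wise lower bound `b ≤ β` on the boxes (`BetaLowerH b γ β`, `b > 0` — UNPRINTED input, as above),
`Σ_{i≤K} (g^A_i)² g^B_{i+1} ≤ γ³ + 2γ/b` (the case `k₀ = 0` of `sum_weights_le_of_eventualLower`: by
`inv_sq_lower_of_betaLower` for each run `(g^A_i)² ≤ 1/a_{K−i}` and `g^B_{i+1} ≤ 1/√a_{K−i}`; reflect the sum, split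
off `m = 0` (`= γ³`) and telescope the rest with `inv_cube_le_telescope` (`≤ (2/b)·(1/√a_0) = 2γ/b`)).  This is the
input `U` of `disc_le_of_fadingMemory` and the bound on the exponent of `disc_le_of_lastOnly`.
[cite: Balaban1987RG1, (0.31) p.259] -/
theorem sum_weights_le_of_betaLower {β : HBeta} {γ b : ℝ} {K : ℕ} {gA gB : ℕ → ℝ}
    (hγ : 0 < γ) (hb : 0 < b) (hA : RGEqH K β gA) (hB : RGEqH (K + 1) β gB)
    (hAbox : ∀ i, i ≤ K → 0 < gA i ∧ gA i ≤ γ) (hBbox : ∀ i, i ≤ K + 1 → 0 < gB i ∧ gB i ≤ γ)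
    (hlo : BetaLowerH b γ β) :
    ∑ i ∈ range (K + 1), (gA i) ^ 2 * gB (i + 1) ≤ γ ^ 3 + 2 * γ / b := by
  simpa using sum_weights_le_of_eventualLower hγ hb hA hB hAbox hBbox (eventualLowerH_of_betaLowerH hlo 0)

/-! ## §5 Output in the `T4CauchySum.InjectedRate` shape, for a family of IR-pinned runs -/

/-- **NODE U2 IN THE SPINE'S SHAPE (consumed by node U6, `T4CauchySum`).**  A family of runs `K ↦ g^{(K)}` of (0.20)
with the same `β` (`RGEqH K β (g K)`), all couplings in ]0,γ], all pinned at the same renormalized coupling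
(`g K K = gIR`: Theorem 2's `g_K = g`, node H3 — UNPUBLISHED, here a hypothesis); NE4 `ScaleShiftRate c θ γ β`; fading
history moduli; a lower bound `b ≤ β` on the boxes; smallness `C(γ³ + 2γ/b) ≤ (1−θ)/2`.  THEN the coupling discrepancies
of consecutive runs form an injected rate with polynomial exponent 0:
`T4CauchySum.InjectedRate (2c/(1−θ)) 0 θ (fun K j ↦ disc (g K) (g (K+1)) j)`.  (Instantiation path in the tree, for
the joiner: `g K := (C ⟨K, m, g₀ K⟩).flow.g` with `DagBinding.rgEqH_of_curries` for `hrun` and `T4Continuum.Tuned` for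
`hbox`/`hpin`; neither module is imported here.)  Bookkeeping over UNPRINTED inputs; nothing of [Balaban1987RG1] is
asserted. [cite: Balaban1987RG1, (0.20) p.256 and Thm 2 p.259] -/
theorem injectedRate_of_runs {β : HBeta} {γ b c θ C : ℝ} {Λ : ℕ → ℕ → ℝ} (g : ℕ → ℕ → ℝ) (gIR : ℝ)
    (hγ : 0 < γ) (hb : 0 < b) (hθ0 : 0 < θ) (hθ1 : θ < 1) (hc : 0 ≤ c) (hC : 0 ≤ C)
    (hrun : ∀ K, RGEqH K β (g K)) (hbox : ∀ K i, i ≤ K → 0 < g K i ∧ g K i ≤ γ)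
    (hpin : ∀ K, g K K = gIR)
    (hS : ScaleShiftRate c θ γ β) (hL : HistLipschitz Λ γ β) (hΛ : FadingMemory C θ Λ)
    (hlo : BetaLowerH b γ β) (hsmall : C * (γ ^ 3 + 2 * γ / b) ≤ (1 - θ) / 2) :
    T4CauchySum.InjectedRate (2 * c / (1 - θ)) 0 θ (fun K j => disc (g K) (g (K + 1)) j) := by
  intro K j hj
  refine ⟨disc_nonneg _ _ _, ?_⟩
  have h := disc_le_of_fadingMemory hθ0 hθ1 hc hC (hrun K) (hrun (K + 1)) (hbox K) (hbox (K + 1))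
    ((hpin K).trans (hpin (K + 1)).symm) hS hL hΛ
    (sum_weights_le_of_betaLower hγ hb (hrun K) (hrun (K + 1)) (hbox K) (hbox (K + 1)) hlo) hsmall j hj
  simpa using h

/-- **NODE U2 IN THE SPINE'S SHAPE — EVENTUAL-AF FORM (v1.1).**  As `injectedRate_of_runs`, with the all-k lower bound
replaced by the EVENTUAL one `EventualLowerH b γ k₀ β` (the `Beta.Assembly.LimitForm.tail_lower` shape; no small-k sign
of the β-functions) and the smallness condition `C((k₀ + 1)γ³ + 2γ/b) ≤ (1−θ)/2` (`sum_weights_le_of_eventualLower`);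
same conclusion `T4CauchySum.InjectedRate (2c/(1−θ)) 0 θ (fun K j ↦ disc (g K) (g (K+1)) j)`.  Bookkeeping over
UNPRINTED inputs; nothing of [Balaban1987RG1] is asserted. [cite: Balaban1987RG1, (0.20) p.256 and Thm 2 p.259] -/
theorem injectedRate_of_runs_eventual {β : HBeta} {γ b c θ C : ℝ} {k₀ : ℕ} {Λ : ℕ → ℕ → ℝ} (g : ℕ → ℕ → ℝ)
    (gIR : ℝ) (hγ : 0 < γ) (hb : 0 < b) (hθ0 : 0 < θ) (hθ1 : θ < 1) (hc : 0 ≤ c) (hC : 0 ≤ C)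
    (hrun : ∀ K, RGEqH K β (g K)) (hbox : ∀ K i, i ≤ K → 0 < g K i ∧ g K i ≤ γ)
    (hpin : ∀ K, g K K = gIR)
    (hS : ScaleShiftRate c θ γ β) (hL : HistLipschitz Λ γ β) (hΛ : FadingMemory C θ Λ)
    (hlo : EventualLowerH b γ k₀ β) (hsmall : C * (((k₀ : ℝ) + 1) * γ ^ 3 + 2 * γ / b) ≤ (1 - θ) / 2) :
    T4CauchySum.InjectedRate (2 * c / (1 - θ)) 0 θ (fun K j => disc (g K) (g (K + 1)) j) := by
  intro K j hj
  refine ⟨disc_nonneg _ _ _, ?_⟩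
  have h := disc_le_of_fadingMemory hθ0 hθ1 hc hC (hrun K) (hrun (K + 1)) (hbox K) (hbox (K + 1))
    ((hpin K).trans (hpin (K + 1)).symm) hS hL hΛ
    (sum_weights_le_of_eventualLower hγ hb (hrun K) (hrun (K + 1)) (hbox K) (hbox (K + 1)) hlo) hsmall j hj
  simpa using h

/-- **NODE U2, LAST-ONLY / EVENTUAL-AF FORM (v1.1, no smallness condition):** with last-coordinate Lipschitz continuity
(`LastOnlyLipschitz L γ β`, [Balaban1987RG1] p. 264: β_{j+1} a function of g_j alone) and the eventual lower bound,
the exponent of `disc_le_of_lastOnly` is K-uniform: `disc ≤ exp(2L((k₀+1)γ³ + 2γ/b)) · (c/(1−θ)) θ^j`, i.e. an injected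
rate `T4CauchySum.InjectedRate (exp(2L((k₀+1)γ³ + 2γ/b))·c/(1−θ)) 0 θ`.  Bookkeeping over UNPRINTED inputs.
[cite: Balaban1987RG1, (0.20) p.256, Thm 2 p.259, §1 p.264] -/
theorem injectedRate_of_runs_lastOnly {β : HBeta} {γ b c θ L : ℝ} {k₀ : ℕ} (g : ℕ → ℕ → ℝ) (gIR : ℝ)
    (hγ : 0 < γ) (hb : 0 < b) (hθ0 : 0 < θ) (hθ1 : θ < 1) (hc : 0 ≤ c) (hL0 : 0 ≤ L) (hLγ : L * γ ^ 3 ≤ 1 / 2)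
    (hrun : ∀ K, RGEqH K β (g K)) (hbox : ∀ K i, i ≤ K → 0 < g K i ∧ g K i ≤ γ)
    (hpin : ∀ K, g K K = gIR)
    (hS : ScaleShiftRate c θ γ β) (hLip : LastOnlyLipschitz L γ β) (hlo : EventualLowerH b γ k₀ β) :
    T4CauchySum.InjectedRate (Real.exp (2 * (L * (((k₀ : ℝ) + 1) * γ ^ 3 + 2 * γ / b))) * c / (1 - θ)) 0 θ
      (fun K j => disc (g K) (g (K + 1)) j) := by
  intro K j hj
  refine ⟨disc_nonneg _ _ _, ?_⟩
  have h := disc_le_of_lastOnly hθ0.le hθ1 hc hL0 hLγ (hrun K) (hrun (K + 1)) (hbox K) (hbox (K + 1))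
    ((hpin K).trans (hpin (K + 1)).symm) hS hLip j hj
  have hU := sum_weights_le_of_eventualLower hγ hb (hrun K) (hrun (K + 1)) (hbox K) (hbox (K + 1)) hlo
  -- the partial exponent sum over `Ico j K` is bounded by the full weight sum
  have hw0 : ∀ i, i ≤ K → 0 ≤ (g K i) ^ 2 * g (K + 1) (i + 1) := fun i hi =>
    mul_nonneg (sq_nonneg _) (hbox (K + 1) (i + 1) (by omega)).1.le
  have hpart : ∑ m ∈ Ico j K, L * ((g K m) ^ 2 * g (K + 1) (m + 1))
      ≤ L * (((k₀ : ℝ) + 1) * γ ^ 3 + 2 * γ / b) := by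
    rw [← Finset.mul_sum]
    refine mul_le_mul_of_nonneg_left (le_trans ?_ hU) hL0
    refine Finset.sum_le_sum_of_subset_of_nonneg (fun m hm => ?_) fun i hi _ => ?_
    · exact mem_range.mpr (by have := (Finset.mem_Ico.mp hm).2; omega)
    · exact hw0 i (Nat.lt_succ_iff.mp (mem_range.mp hi))
  have hexp : Real.exp (2 * ∑ m ∈ Ico j K, L * ((g K m) ^ 2 * g (K + 1) (m + 1)))
      ≤ Real.exp (2 * (L * (((k₀ : ℝ) + 1) * γ ^ 3 + 2 * γ / b))) :=
    Real.exp_le_exp.mpr (by linarith)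
  have hgeom : 0 ≤ c / (1 - θ) * θ ^ j := by
    have : 0 < 1 - θ := by linarith
    positivity
  calc disc (g K) (g (K + 1)) j
      ≤ Real.exp (2 * ∑ m ∈ Ico j K, L * ((g K m) ^ 2 * g (K + 1) (m + 1))) * (c / (1 - θ) * θ ^ j) := h
    _ ≤ Real.exp (2 * (L * (((k₀ : ℝ) + 1) * γ ^ 3 + 2 * γ / b))) * (c / (1 - θ) * θ ^ j) :=
        mul_le_mul_of_nonneg_right hexp hgeom
    _ = Real.exp (2 * (L * (((k₀ : ℝ) + 1) * γ ^ 3 + 2 * γ / b))) * c / (1 - θ) * (((K : ℝ) + 1) ^ (0 : ℕ))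
          * θ ^ j := by ring

/-! ## §6 Format clause (v1.2): (1.20)–(1.22) and the recursion (0.20)/(1.6) are read off the μ = 0 part of a dressed action

[Balaban1987RG1] p. 263 ASSUMES the Euclidean invariance of every term of the effective action and p. 264 USES it for
(1.21), on which the definition (1.22) of β_{j+1} and the limit T^{(j+1)} ↗ ℤ^d rest.  A dressed action E^{(j+1)}_μ of the
cell's observable format (node O3b) is not Euclidean invariant for μ ≠ 0; its μ = 0 part is the undressed action.  The
declarations below TYPE the convention that everything p. 264 extracts is extracted from the μ = 0 part, and check that
node U2 then never sees μ.  Hypothesis shapes and definitions only; nothing of the paper is asserted. -/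

/-- The object of (1.20) p. 264 as "a function of μ, ν, x, x′" (the colour factor δ^{ab} of (1.21) stripped, the
arguments j, g_j and the history suppressed, sites of ℤ^d after the limit T^{(j+1)} ↗ ℤ^d as in `B12Beta.Kernel`):
`P μ ν x x′`.  A carrier type; nothing asserted. [cite: Balaban1987RG1, (1.20) p.264] -/
abbrev TwoPoint (d : ℕ) : Type := Fin d → Fin d → (Fin d → ℤ) → (Fin d → ℤ) → ℝ

/-- The translation half of "the function (1.20) is Euclidean covariant. This implies Π^{ab}_{j+1,μν}(g_j, x, x′) =
δ^{ab}Π_{j+1,μν}(g_j, x − x′)" ((1.21) p. 264, first line): the two-point function is unchanged under a common shift of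
both sites.  A HYPOTHESIS SHAPE on an abstract two-point function (for the undressed action it is the p. 263 assumption,
verified for the small-field actions by Theorem 3 p. 264; for a dressed action with μ ≠ 0 it is not expected to hold —
`t4/T4-REF-O3.md` V6). [cite: Balaban1987RG1, (1.21) p.264] -/
def TranslationInvariant {d : ℕ} (P : TwoPoint d) : Prop :=
  ∀ (μ ν : Fin d) (x x' a : Fin d → ℤ), P μ ν (x + a) (x' + a) = P μ ν x x'

/-- The kernel "Π_{j+1,μν}(g_j, x)" that (1.21) reads off a two-point function: freeze the second site at the origin.
[cite: Balaban1987RG1, (1.21) p.264] -/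
def toKernel {d : ℕ} (P : TwoPoint d) : B12Beta.Kernel d := fun μ ν x => P μ ν x 0

/-- (1.21) p. 264, first line, as a kernel-checked consequence of translation invariance: `P μ ν x x′ = Π μ ν (x − x′)`
with `Π = toKernel P`. [cite: Balaban1987RG1, (1.21) p.264] -/
theorem toKernel_spec {d : ℕ} {P : TwoPoint d} (h : TranslationInvariant P) (μ ν : Fin d) (x x' : Fin d → ℤ) :
    P μ ν x x' = toKernel P μ ν (x - x') := by
  have hx := h μ ν (x - x') 0 x'
  simp only [sub_add_cancel, zero_add] at hx
  exact hx

/-- **THE FORMAT CLAUSE, generic form.**  A quantity indexed by the observable strength μ of the dressed format,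
`q : ℝ → α` (the dressed two-point functions, kernels, β-families, counterterms …), is READ OFF THE μ = 0 PART when
`q μ = q 0` for every μ.  A convention of the cell's format (`t4/T4-REF-O3.md` V6, GAPS G-pv10-7), typed as a `Prop`;
nothing of [Balaban1987RG1] is asserted. [cite: Balaban1987RG1, §1 p.263 (Euclidean invariance assumption) and (1.20)-(1.22) p.264] -/
def ReadOffMuZero {α : Type*} (q : ℝ → α) : Prop := ∀ μ, q μ = q 0

/-- A quantity read off the μ = 0 part takes the same value at any two observable strengths. [folklore] -/
theorem ReadOffMuZero.eq {α : Type*} {q : ℝ → α} (h : ReadOffMuZero q) (μ μ' : ℝ) : q μ = q μ' :=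
  (h μ).trans (h μ').symm

/-- A μ-independent quantity is (trivially) read off the μ = 0 part. [folklore] -/
theorem readOffMuZero_const {α : Type*} (a : α) : ReadOffMuZero (fun _ : ℝ => a) := fun _ => rfl

/-- Anything computed from a quantity read off the μ = 0 part is read off the μ = 0 part. [folklore] -/
theorem ReadOffMuZero.comp {α γ : Type*} {q : ℝ → α} (h : ReadOffMuZero q) (Φ : α → γ) :
    ReadOffMuZero (fun μ => Φ (q μ)) := fun μ => congrArg Φ (h μ)

/-- **THE FORMAT'S DEFINITION of the kernel Π_{j+1} of (1.21)** from a μ-DRESSED family of two-point functions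
`Pd : ℝ → TwoPoint d` (μ ↦ the second B-variation (1.20) of the dressed action E^{(j+1)}_μ at B = 0): it is computed
from the μ = 0 member `Pd 0` — the undressed action's (1.20) — and from nothing else.  A definition (convention), not a
claim. [cite: Balaban1987RG1, (1.20)-(1.21) p.264] -/
def kernelMuZero {d : ℕ} (Pd : ℝ → TwoPoint d) : B12Beta.Kernel d := toKernel (Pd 0)

/-- **THE FORMAT'S DEFINITION of the number (1.22)** "β_{j+1}(g_j) = Σ_x Π_{j+1,μν}(g_j, x)x_μx_ν for μ, ν arbitrary,
μ ≠ ν" from a μ-dressed family of two-point functions: the second moment (`B12Beta.secondMoment`) of the kernel read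
off the μ = 0 member.  A definition (convention), not a claim. [cite: Balaban1987RG1, (1.22) p.264] -/
noncomputable def betaMuZero {d : ℕ} (Pd : ℝ → TwoPoint d) (μ ν : Fin d) : ℝ :=
  B12Beta.secondMoment (kernelMuZero Pd) μ ν

/-- The format's Π_{j+1} and β_{j+1} depend on the dressed family ONLY through its μ = 0 member ("functions of the
μ = 0 part"): two dressed families with the same undressed member give the same kernel and the same number (1.22).
[folklore] -/
theorem betaMuZero_congr {d : ℕ} {Pd Pd' : ℝ → TwoPoint d} (h0 : Pd 0 = Pd' 0) :
    kernelMuZero Pd = kernelMuZero Pd' ∧ betaMuZero Pd = betaMuZero Pd' := by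
  have hk : kernelMuZero Pd = kernelMuZero Pd' := by simp only [kernelMuZero, h0]
  refine ⟨hk, ?_⟩
  funext μ ν
  simp only [betaMuZero, hk]

/-- (1.21), first line, for the format's kernel: GIVEN the translation invariance of the μ = 0 member (the p. 263
assumption for the undressed action), `Pd 0 μ ν x x′ = kernelMuZero Pd μ ν (x − x′)`.  Nothing is claimed for μ ≠ 0.
[cite: Balaban1987RG1, (1.21) p.264] -/
theorem kernelMuZero_spec {d : ℕ} {Pd : ℝ → TwoPoint d} (h : TranslationInvariant (Pd 0)) (μ ν : Fin d)
    (x x' : Fin d → ℤ) : Pd 0 μ ν x x' = kernelMuZero Pd μ ν (x - x') :=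
  toKernel_spec h μ ν x x'

/-- **The observable never feeds (0.20)/(1.6).**  If a dressed format proposes a μ-indexed family of history β-functions
`βd : ℝ → HBeta` obeying the clause `ReadOffMuZero βd`, then the recursion (0.20) at strength μ IS the undressed one.
[cite: Balaban1987RG1, (0.20) p.256] -/
theorem rgEqH_dressed_iff {βd : ℝ → HBeta} (h : ReadOffMuZero βd) (μ : ℝ) (K : ℕ) (g : ℕ → ℝ) :
    RGEqH K (βd μ) g ↔ RGEqH K (βd 0) g := by
  rw [h μ]

/-- Under the clause, μ-indexed families of dressed runs `gd : ℝ → ℕ → ℕ → ℝ` that are read off μ = 0 have the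
undressed discrepancies: `disc (gd μ K) (gd μ (K+1)) = disc (gd 0 K) (gd 0 (K+1))`. [folklore] -/
theorem disc_dressed_eq {gd : ℝ → ℕ → ℕ → ℝ} (h : ReadOffMuZero gd) (μ : ℝ) (K j : ℕ) :
    disc (gd μ K) (gd μ (K + 1)) j = disc (gd 0 K) (gd 0 (K + 1)) j := by
  rw [h μ]

/-- **NODE U2 FOR DRESSED RUNS = NODE U2 (v1.2).**  A family of dressed runs at observable strength μ, generated by a
μ-indexed β-family read off the μ = 0 part (`ReadOffMuZero βd`), with §5's hypotheses placed on the UNDRESSED family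
`βd 0` only, has §5's injected rate `T4CauchySum.InjectedRate (2c/(1−θ)) 0 θ` — the constant, the exponent and the
ratio do not depend on μ.  Plumbing over `injectedRate_of_runs_eventual`; bookkeeping over UNPRINTED inputs; nothing of
[Balaban1987RG1] is asserted. [cite: Balaban1987RG1, (0.20) p.256 and Thm 2 p.259] -/
theorem injectedRate_of_dressedRuns_eventual {βd : ℝ → HBeta} (hμ : ReadOffMuZero βd) (μ : ℝ)
    {γ b c θ C : ℝ} {k₀ : ℕ} {Λ : ℕ → ℕ → ℝ} (g : ℕ → ℕ → ℝ) (gIR : ℝ)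
    (hγ : 0 < γ) (hb : 0 < b) (hθ0 : 0 < θ) (hθ1 : θ < 1) (hc : 0 ≤ c) (hC : 0 ≤ C)
    (hrun : ∀ K, RGEqH K (βd μ) (g K)) (hbox : ∀ K i, i ≤ K → 0 < g K i ∧ g K i ≤ γ)
    (hpin : ∀ K, g K K = gIR)
    (hS : ScaleShiftRate c θ γ (βd 0)) (hL : HistLipschitz Λ γ (βd 0)) (hΛ : FadingMemory C θ Λ)
    (hlo : EventualLowerH b γ k₀ (βd 0)) (hsmall : C * (((k₀ : ℝ) + 1) * γ ^ 3 + 2 * γ / b) ≤ (1 - θ) / 2) :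
    T4CauchySum.InjectedRate (2 * c / (1 - θ)) 0 θ (fun K j => disc (g K) (g (K + 1)) j) :=
  injectedRate_of_runs_eventual g gIR hγ hb hθ0 hθ1 hc hC (fun K => (rgEqH_dressed_iff hμ μ K (g K)).mp (hrun K))
    hbox hpin hS hL hΛ hlo hsmall

end Literature.MathematicalPhysics.QuantumFieldTheory.Balaban1983to89.T4CouplingMatching
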